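import Literature.Probability.RandomPlanarGeometry.HexSAWBrickWallStripFugacityWidthOneSexticLaw
import Literature.Probability.RandomPlanarGeometry.HexSAWBrickWallStripFugacityWidthOneParityAmplitude
import Literature.Probability.RandomPlanarGeometry.HexSAWBrickWallStripFugacityTwoSidedProp6
import Literature.Probability.RandomPlanarGeometry.HexSAWBrickWallStripWidthOneSpeed
import Literature.Probability.RandomPlanarGeometry.HexSAWBrickWallStripFugacityWidthOneSpeed
import Mathlib.Analysis.SpecialFunctions.Pow.Deriv
import Mathlib.Analysis.SpecialFunctions.Pow.Continuity
import Mathlib.Analysis.Calculus.Deriv.Slope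
import Mathlib.Analysis.SpecificLimits.Basic
import Mathlib.Analysis.Convex.Deriv
import HarnessLib

/-!
# The contact density of the adsorbing self-avoiding walk in the one-cell honeycomb strip

Beaton–Bousquet-Mélou–de Gier–Duminil-Copin–Guttmann [BBdGDCG2014, §3.2, arXiv v5 p. 10] weigh the `N`-step
self-avoiding walks `ω` of the honeycomb strip `S_T` by `y^{bc(ω)} z^{tc(ω)}` (`bc`, `tc` = contacts with the bottom /
top of the strip; tree: `bottomVisits₀`, `topVisits₀ 1`, partition function `stripZ₂ 1 N y z = C_{1,N}(y,z)`) and prove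
(Proposition 6) that `μ_1(y,z) = lim C_{1,N}(y,z)^{1/N}` exists; the tree's SEXTIC LAW (`stripMuY₂_one_sq_poly_eq`) says
that `s = μ_1(y,z)²` is the root above `max(y,z)` of `s(s − y)(s − z) = yz`.  The ADSORBED FRACTION `bc(ω)/N` is the order
parameter of polymer adsorption (Madras–Slade [MadrasSlade1993, §8.5 pp. 278–279] for the one-dimensional / Markovian
structure of strip walks after Alm–Janson [AlmJanson1990]).  This file proves, for the one-cell strip and EVERY `y, z > 0`,
the law of large numbers for both contact counts under `P_{N,y,z} ∝ y^{bc} z^{tc}` with the explicit closed forms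
`b(y,z) = s(s − z) / (2F(s))`, `b_top(y,z) = b(z,y) = s(s − y)/(2F(s))`, `F(s) = (s−y)(s−z) + s(s−z) + s(s−y)` (`= ∂_s` of the
sextic polynomial; `b = y ∂_y log μ_1`, `b_top = z ∂_z log μ_1`), with exponentially small tails, and the consistency
`b(1,1) = (μ+1)/(2(2μ+3)) = v/4` with the speed `v` of `HexBW.stripOneSpeed` (`μ³ = μ + 1`).  No printed source in our
holdings states these closed forms; the qualitative LLN is folklore-via-transfer-matrix (Alm–Janson).

## Main statements

§1 `sexticDeriv` (`F`), **`contactB`** (`b(y,z)`), `contactB_facts` (`y, z < s`, `F(s) > 0`, sextic, `0 < b < 1/2`),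
`contactB_swap` (`b(z,y) = s(s−y)/(2F(s))`).
§2 `tiltG` (`G(u) = S(S − yu)(S − z) − yuz`, `S = s u^{2c}`), `tiltG_one`, ★ `hasDerivAt_tiltG`
(`G'(1) = 2cs F(s) − y(s(s−z)+z)`), ★ `tiltG_eventually_pos` (slope sign ⇒ `G > 0` on the correct side of `1`).
§3 ★★ **`exists_contactTilt_gt`**: `κ > b(y,z) ⇒ ∃ u > 1, η > 0, μ_1(yu,z)(1+η) < μ_1(y,z) u^κ`; ★★ **`exists_contactTilt_lt`**
(`κ < b ⇒` the same with `0 < u < 1`).  [The criterion `stripMuY₂_one_le_iff` of the tree turns `μ_1(yu,z) ≤ μ_1(y,z)u^c`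
into `G(u) ≥ 0`; `G(1) = 0` is the sextic law and the sign of `G'(1)` is the sign of `c − b(y,z)` because
`y(s(s−z)+z) = s²(s−z)` by the sextic law.]
§4 (with the tree's walk weight `HexBW.wgt y z N q = y^{bc} z^{tc}` of the previous file) ★ `wgt_tilt`
(`wgt (yu) z = wgt y z · u^{bc}`),
★★ `sum_contacts_ge_mul_rpow_le` / `sum_contacts_le_mul_rpow_le` (Chernoff: `(Σ_{bc ≥ κN} y^{bc}z^{tc})·u^{κN} ≤ C_{1,N}(yu,z)`
for `u ≥ 1`, and the lower-tail twin for `u ≤ 1`), ★★ `fraction_le_geometric_of_tilt` (tilt + `C_{1,N}(yu,z) ≤ (μ_1(yu,z)(1+η))^N`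
eventually + `μ_1(y,z)^N ≤ K(y)K(z) C_{1,N}(y,z)` ⇒ geometric decay of the fraction).
§5 ★★★ **`contacts_ge_fraction_le`** / ★★★ **`contacts_le_fraction_le`** (for `κ > b(y,z)`, resp. `κ < b(y,z)`:
`P_{N,y,z}(bc ≥ κN)`, resp. `P_{N,y,z}(bc ≤ κN)`, is `≤ C θ^N` for all large `N`, `θ < 1`), `contactDevPairs`,
★★★ **`tendsto_contactDevFraction : P_{N,y,z}(|bc(ω)/N − b(y,z)| ≥ ε) → 0`** — THE CONTACT DENSITY LAW, every `y, z > 0`,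
`meanContacts`, ★★★ **`tendsto_meanContacts_div : ⟨bc(ω)⟩_{N,y,z}/N → b(y,z)`**.
§6 (top contacts, tilting `z`, `stripMuY₂_symm`) `wgt_tilt_top`, `sum_topContacts_ge/le_mul_rpow_le`,
`fraction_le_geometric_of_tilt_top`, ★★★ **`tendsto_topContactDevFraction : P_{N,y,z}(|tc(ω)/N − b(z,y)| ≥ ε) → 0`**.
§7 ★ **`contactB_one_one : contactB 1 1 = stripOneSpeed / 4`**.
§8 ★★ **`contactB_add_contactB_swap : contactB y z + contactB z y = twoWallSpeed y z / 2`** (every `y, z > 0`; the two-wall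
speed of `HexSAWBrickWallStripFugacityWidthOneSpeed`): half of the steps land on surface sites, split `(s−z) : (s−y)`.
§9 (ed.2) `tiltG_eventually_neg`, `eventually_tilt_criteria`, ★★ `eventually_slope_log_stripMuY₂_sandwich`,
★★★ **`hasDerivAt_log_stripMuY₂_tilt : HasDerivAt (fun u => log μ_1(yu,z)) (contactB y z) 1`** and
★★★ **`hasDerivAt_log_stripMuY₂_one : HasDerivAt (fun y' => log μ_1(y',z)) (contactB y z / y) y`** — the free energy
`log μ_1` IS differentiable in the fugacity and its logarithmic derivative IS the contact density (all `y, z > 0`).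
§10 (ed.2) `convexOn_log_stripMuY₂_one_exp_left` (section of the tree's joint log-convexity `convexOn_log_stripMuY₂_exp`),
`hasDerivAt_log_stripMuY₂_exp`, ★★★ **`contactB_mono_left : y ≤ y' → b(y,z) ≤ b(y',z)`** (more attraction, more contacts — convex
free energy + `ConvexOn.monotoneOn_deriv`), `contactB_swap_mono` (the top density in its own fugacity).
§11 (ed.3) the phase portrait in `y`: `stripMuY₂_one_sq_sub_le` (`s − y ≤ z/(y−z)` for `y > z`; `s − z ≤ 2y/z` for `2y ≤ z`),
★★ `abs_contactB_sub_half_le` (`|b − 1/2| ≤ z/(y−z)²`), ★★ `contactB_le_of_small` (`b ≤ 2y/z²`), ★★★ **`tendsto_contactB_atTop`**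
(`b(y,z) → 1/2` as `y → ∞`: SATURATION — every other bottom site is a contact) and ★★★ **`tendsto_contactB_nhdsGT_zero`**
(`b(y,z) → 0` as `y → 0⁺`: DESORPTION).
§12 (ed.3) the phase portrait in `z` (bounds swapped via `stripMuY₂_symm`): `stripMuY₂_one_sq_sub_le'`, ★★ `contactB_le_of_large_top`
(`b ≤ y/(2(z−y)²)`, `z > y`), ★★ `abs_contactB_sub_half_le_of_small_top` (`|b − 1/2| ≤ 4z/y²`, `2z ≤ y`),
★★★ **`tendsto_contactB_atTop_right`** (`b(y,z) → 0` as `z → ∞`) and ★★★ **`tendsto_contactB_nhdsGT_zero_right`** (`b(y,z) → 1/2` as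
`z → 0⁺`: with a repelling top wall the walk lives on the bottom row).
§13 (ed.3) ★ `contactB_eq_elim` (`b = 1/(2(3 − 2y/s + (s−y)²/y))`, `z` eliminated by the sextic), ★★★ **`contactB_strictAnti_right :
z < z' → b(y,z') < b(y,z)`** (COMPETITION BETWEEN THE WALLS — derivative-free, from the tree's `stripMuY₂_one_strictMono_right`),
`contactB_swap_strictAnti`.
§14 (ed.4) ★ `contactB_eq_elim'` (`b = 1/(2(1 + z(2s−z)/((s−z)(s(s−z)+z))))`, `y` eliminated), ★★★ **`contactB_strictMono_left :
y < y' → b(y,z) < b(y',z)`** (the adsorbed fraction is STRICTLY increasing in its own fugacity — derivative-free, from the tree's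
`stripMuY₂_one_strictMono_left`; sharpens ed.2's `contactB_mono_left`), ★★ `contactB_lt_swap_iff` (`b(y,z) < b(z,y) ↔ y < z`:
the more attractive wall carries more contacts), `contactB_eq_swap_iff`.
§15 (ed.5) consequences for the two-wall SPEED of #525 via `v = 2(b + b_top)`: ★★ `tendsto_twoWallSpeed_atTop` (`v(y,z) → 1`, `y → ∞`),
★★ `tendsto_twoWallSpeed_nhdsGT_zero` (`v(y,z) → 1`, `y → 0⁺`: a repelling bottom wall sends the walk along the top wall), ★★
`twoWallSpeed_mem_Ioo` (`2/3 < v(y,z) < 1` for all `y, z > 0`), ★★ `twoWallSpeed_self` (`v(y,y) = 1 − 1/(2μ_1(y,y) + 3)`: the diagonal keeps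
the shape of the unweighted formula).

## Sources

[BBdGDCG2014] N. R. Beaton, M. Bousquet-Mélou, J. de Gier, H. Duminil-Copin, A. J. Guttmann, *The critical fugacity for
surface adsorption of self-avoiding walks on the honeycomb lattice is 1 + √2*, CMP 326 (2014); arXiv:1109.0358v5, §3.2
p. 10 (`C_{T,k}(y,z)`, Proposition 6).  [MadrasSlade1993] N. Madras, G. Slade, *The Self-Avoiding Walk* (1993), §1.2,
§8.5 pp. 278–279.  [AlmJanson1990] S. E. Alm, S. Janson, *Random self-avoiding walks on one-dimensional lattices*, Comm.
Statist. Stochastic Models 6 (1990) 169–212 (cited via [MadrasSlade1993, §8.5]; not held).  No quotation AS PRINTED.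

METHOD (own route; no automaton, no potential): exponential tilting of the fugacity itself — `y ↦ yu` multiplies the
weight of every walk by `u^{bc}` — so Chernoff's bound compares `C_{1,N}(yu,z)` with `C_{1,N}(y,z)`; the growth rates are
compared through the tree's monotone criterion for `μ_1` (the sextic law), and the first-order condition at `u = 1` is
exactly `κ ≷ b(y,z)`; Fekete-type bounds of the tree (`eventually_stripZ₂_one_le_pow₂`, `stripMuY₂_one_pow_le`) close
the estimate.  NOT CLAIMED: fluctuations (CLT / variance `∂²`), the joint law of `(bc, tc)`, strips of width `T ≥ 2`.
-/

noncomputable section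

open Filter Topology Finset Literature.Probability.LatticeModels Literature.Probability.Percolation SimpleGraph

namespace Literature.Probability.RandomPlanarGeometry.SAW.HexBW

open WidthOneYZ

variable {y z : ℝ}

/-! ## §1 The constants: `F(s) = (s−y)(s−z) + s(s−z) + s(s−y)` and the contact densities -/

/-- `F_{y,z}(s) = (s−y)(s−z) + s(s−z) + s(s−y)` — the `s`-derivative of the sextic polynomial `s(s−y)(s−z) − yz`.
[cite: BeatonBousquetMelouDeGierDuminilCopinGuttmann2014, §3.2 Proposition 6 (arXiv v5 p. 10)] -/
def sexticDeriv (y z s : ℝ) : ℝ := (s - y) * (s - z) + s * (s - z) + s * (s - y)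

/-- ★ **The bottom contact density** `b(y,z) = s(s − z) / (2 F_{y,z}(s))`, `s = μ_1(y,z)²` (= `y ∂_y log μ_1(y,z)` by implicit
differentiation of the sextic law; e.g. `b(1,1) = μ²/(2(3μ²−1)) = (μ+1)/(2(2μ+3)) ≈ 0.2057`).
[cite: BeatonBousquetMelouDeGierDuminilCopinGuttmann2014, §3.2 Proposition 6 (arXiv v5 p. 10); MadrasSlade1993, §1.2 (elementary)] -/
def contactB (y z : ℝ) : ℝ :=
  stripMuY₂ 1 y z ^ 2 * (stripMuY₂ 1 y z ^ 2 - z) / (2 * sexticDeriv y z (stripMuY₂ 1 y z ^ 2))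

/-- Basic facts at `s = μ_1(y,z)²`: `y, z < s`, `F(s) > 0`, the sextic law, `0 < b(y,z) < 1/2`.
[cite: BeatonBousquetMelouDeGierDuminilCopinGuttmann2014, §3.2 Proposition 6 (arXiv v5 p. 10)] -/
theorem contactB_facts (hy : 0 < y) (hz : 0 < z) :
    y < stripMuY₂ 1 y z ^ 2 ∧ z < stripMuY₂ 1 y z ^ 2 ∧ 0 < sexticDeriv y z (stripMuY₂ 1 y z ^ 2) ∧
    stripMuY₂ 1 y z ^ 2 * (stripMuY₂ 1 y z ^ 2 - y) * (stripMuY₂ 1 y z ^ 2 - z) = y * z ∧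
    0 < contactB y z ∧ contactB y z < 1 / 2 := by
  obtain ⟨hys, hzs⟩ := lt_stripMuY₂_one_sq₂ hy hz
  set s := stripMuY₂ 1 y z ^ 2 with hs
  have hs0 : 0 < s := hy.trans hys
  have hF : 0 < sexticDeriv y z s := by unfold sexticDeriv; nlinarith [mul_pos (sub_pos.2 hys) (sub_pos.2 hzs)]
  have hnum : 0 < s * (s - z) := mul_pos hs0 (sub_pos.2 hzs)
  refine ⟨hys, hzs, hF, stripMuY₂_one_sq_poly_eq hy hz, ?_, ?_⟩
  · unfold contactB; rw [← hs]; positivity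
  · unfold contactB; rw [← hs, div_lt_iff₀ (by positivity)]
    unfold sexticDeriv
    nlinarith [mul_pos (sub_pos.2 hys) (sub_pos.2 hzs), mul_pos hs0 (sub_pos.2 hys)]

/-- **Symmetry**: the top contact density is `b(z,y)` (`μ_1(y,z) = μ_1(z,y)`, `F_{y,z} = F_{z,y}`); explicitly
`b(z,y) = s(s − y)/(2F_{y,z}(s))`. [cite: BeatonBousquetMelouDeGierDuminilCopinGuttmann2014, Proposition 6 (arXiv v5 p. 10: μ_T(y,z) symmetric)] -/
theorem contactB_swap (y z : ℝ) :
    contactB z y = stripMuY₂ 1 y z ^ 2 * (stripMuY₂ 1 y z ^ 2 - y) / (2 * sexticDeriv y z (stripMuY₂ 1 y z ^ 2)) := by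
  unfold contactB sexticDeriv; rw [stripMuY₂_symm 1 z y]; ring_nf

/-! ## §2 The tilt polynomial `G(u) = S(S − yu)(S − z) − yuz`, `S = s u^{2c}`, and its derivative at `u = 1` -/

/-- `G_{y,z,s,c}(u) = s u^{2c} (s u^{2c} − y u)(s u^{2c} − z) − y u z`. [cite: BeatonBousquetMelouDeGierDuminilCopinGuttmann2014, §3.2 Proposition 6 (arXiv v5 p. 10) (lane plumbing)] -/
def tiltG (y z s c u : ℝ) : ℝ := s * u ^ (2 * c) * (s * u ^ (2 * c) - y * u) * (s * u ^ (2 * c) - z) - y * u * z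

/-- `G(1) = s(s−y)(s−z) − yz`. [cite: BeatonBousquetMelouDeGierDuminilCopinGuttmann2014, §3.2 Proposition 6 (arXiv v5 p. 10) (lane plumbing)] -/
theorem tiltG_one (y z s c : ℝ) : tiltG y z s c 1 = s * (s - y) * (s - z) - y * z := by
  simp [tiltG, Real.one_rpow]

/-- `G'(1) = 2c s F(s) − y (s(s−z) + z)`. [cite: BeatonBousquetMelouDeGierDuminilCopinGuttmann2014, §3.2 Proposition 6 (arXiv v5 p. 10) (lane plumbing)] -/
theorem hasDerivAt_tiltG (y z s c : ℝ) :
    HasDerivAt (tiltG y z s c) (2 * c * s * sexticDeriv y z s - y * (s * (s - z) + z)) 1 := by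
  have hP : HasDerivAt (fun u : ℝ => u ^ (2 * c)) (2 * c) 1 := by
    have := Real.hasDerivAt_rpow_const (x := (1 : ℝ)) (p := 2 * c) (Or.inl one_ne_zero)
    simpa using this
  have hS : HasDerivAt (fun u : ℝ => s * u ^ (2 * c)) (s * (2 * c)) 1 := hP.const_mul s
  have hA : HasDerivAt (fun u : ℝ => s * u ^ (2 * c) - y * u) (s * (2 * c) - y * 1) 1 := hS.sub ((hasDerivAt_id 1).const_mul y)
  have hB : HasDerivAt (fun u : ℝ => s * u ^ (2 * c) - z) (s * (2 * c)) 1 := by simpa using hS.sub_const z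
  have hL : HasDerivAt (fun u : ℝ => y * u * z) (y * 1 * z) 1 := ((hasDerivAt_id 1).const_mul y).mul_const z
  have h := ((hS.fun_mul hA).fun_mul hB).fun_sub hL
  have e : (fun u : ℝ => s * u ^ (2 * c) * (s * u ^ (2 * c) - y * u) * (s * u ^ (2 * c) - z) - y * u * z) =
      tiltG y z s c := rfl
  rw [e] at h
  refine h.congr_deriv ?_
  rw [Real.one_rpow, sexticDeriv]
  ring

/-- ★ **Sign of the slope decides the tilt**: if `G(1) = 0` and `G'(1) > 0` then `G(u) > 0` for `u` slightly above `1`;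
if `G'(1) < 0` then `G(u) > 0` for `u` slightly below `1`. [cite: MadrasSlade1993, §1.2 (elementary calculus)] -/
theorem tiltG_eventually_pos (y z s c : ℝ) (h0 : tiltG y z s c 1 = 0) :
    (0 < 2 * c * s * sexticDeriv y z s - y * (s * (s - z) + z) → ∀ᶠ u in 𝓝[>] 1, 0 < tiltG y z s c u) ∧
    (2 * c * s * sexticDeriv y z s - y * (s * (s - z) + z) < 0 → ∀ᶠ u in 𝓝[<] 1, 0 < tiltG y z s c u) := by
  have hD := hasDerivAt_tiltG y z s c
  constructor
  · intro hpos
    have hslope := (hasDerivAt_iff_tendsto_slope.1 hD).eventually (lt_mem_nhds hpos)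
    have hev1 : ∀ᶠ u in 𝓝[>] (1 : ℝ), 0 < slope (tiltG y z s c) 1 u :=
      hslope.filter_mono (nhdsWithin_mono _ fun u hu => ne_of_gt hu)
    have hev2 : ∀ᶠ u in 𝓝[>] (1 : ℝ), 1 < u := eventually_mem_nhdsWithin
    filter_upwards [hev1, hev2] with u h1 h2
    rw [slope_def_field, h0, sub_zero] at h1
    rcases div_pos_iff.1 h1 with ⟨hp, -⟩ | ⟨-, hneg⟩
    · exact hp
    · linarith
  · intro hneg
    have hslope := (hasDerivAt_iff_tendsto_slope.1 hD).eventually (gt_mem_nhds hneg)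
    have hev1 : ∀ᶠ u in 𝓝[<] (1 : ℝ), slope (tiltG y z s c) 1 u < 0 :=
      hslope.filter_mono (nhdsWithin_mono _ fun u hu => ne_of_lt hu)
    have hev2 : ∀ᶠ u in 𝓝[<] (1 : ℝ), u < 1 := eventually_mem_nhdsWithin
    filter_upwards [hev1, hev2] with u h1 h2
    rw [slope_def_field, h0, sub_zero] at h1
    rcases div_neg_iff.1 h1 with ⟨hp, -⟩ | ⟨hneg', hpos'⟩
    · exact hp
    · linarith

/-! ## §3 The analytic tilts: `μ_1(yu, z) ≤ μ_1(y,z)·u^c` for `u` near `1` on the correct side -/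

/-- ★★ **Upper tilt**: for `κ > b(y,z)` there are `u > 1` and `η > 0` with `μ_1(yu,z)(1+η) < μ_1(y,z) u^κ`.
[cite: BeatonBousquetMelouDeGierDuminilCopinGuttmann2014, §3.2 Proposition 6 (arXiv v5 p. 10); MadrasSlade1993, §1.2] -/
theorem exists_contactTilt_gt (hy : 0 < y) (hz : 0 < z) {κ : ℝ} (hκ : contactB y z < κ) :
    ∃ u η : ℝ, 1 < u ∧ 0 < η ∧ stripMuY₂ 1 (y * u) z * (1 + η) < stripMuY₂ 1 y z * u ^ κ := by
  obtain ⟨hys, hzs, hF, hsex, hb0, -⟩ := contactB_facts hy hz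
  set μ := stripMuY₂ 1 y z with hμ
  have hμ0 : 0 < μ := stripMuY₂_pos 1 hy hz
  set s := μ ^ 2 with hs
  have hs0 : 0 < s := by positivity
  set c := (contactB y z + κ) / 2 with hc
  have hcb : contactB y z < c := by rw [hc]; linarith
  have hcκ : c < κ := by rw [hc]; linarith
  -- derivative sign: `2cs F − y(s(s−z)+z) = s(2cF − s(s−z))` via `yz = s(s−y)(s−z)`
  have hder : 0 < 2 * c * s * sexticDeriv y z s - y * (s * (s - z) + z) := by
    have e : y * (s * (s - z) + z) = s * (s * (s - z)) := by linear_combination (-1 : ℝ) * hsex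
    rw [e]
    have : s * (s - z) < 2 * c * sexticDeriv y z s := by
      have h := hcb; unfold contactB at h; rw [← hμ, ← hs, div_lt_iff₀ (by positivity)] at h; linarith
    nlinarith
  have h0 : tiltG y z s c 1 = 0 := by rw [tiltG_one]; linarith
  have hev1 := (tiltG_eventually_pos y z s c h0).1 hder
  have hev2 : ∀ᶠ u in 𝓝[>] (1 : ℝ), 1 < u := eventually_mem_nhdsWithin
  -- `max(yu, z) < s u^{2c}` near `u = 1`
  have hcont : ContinuousAt (fun u : ℝ => s * u ^ (2 * c) - max (y * u) z) 1 :=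
    (continuousAt_const.mul (Real.continuousAt_rpow_const _ _ (Or.inl one_ne_zero))).sub
      ((continuousAt_const.mul continuousAt_id).max continuousAt_const)
  have hat1 : 0 < s * (1 : ℝ) ^ (2 * c) - max (y * 1) z := by
    rw [Real.one_rpow, mul_one, mul_one]; exact sub_pos.2 (max_lt hys hzs)
  have hev3 : ∀ᶠ u in 𝓝[>] (1 : ℝ), 0 < s * u ^ (2 * c) - max (y * u) z :=
    (hcont.eventually (lt_mem_nhds hat1)).filter_mono nhdsWithin_le_nhds
  obtain ⟨u, hG, hu1, hm⟩ := (hev1.and (hev2.and hev3)).exists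
  have hu0 : 0 < u := zero_lt_one.trans hu1
  -- apply the criterion `μ_1(yu,z) ≤ ρ ↔ (yu)z ≤ ρ²(ρ²−yu)(ρ²−z)` with `ρ = μ u^c`
  set ρ := μ * u ^ c with hρ
  have hρ0 : 0 < ρ := mul_pos hμ0 (Real.rpow_pos_of_pos hu0 c)
  have hρ2 : ρ ^ 2 = s * u ^ (2 * c) := by
    rw [hρ, mul_pow, hs, ← Real.rpow_natCast (u ^ c) 2, ← Real.rpow_mul hu0.le]; push_cast; ring_nf
  have hle : stripMuY₂ 1 (y * u) z ≤ ρ := by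
    rw [stripMuY₂_one_le_iff (mul_pos hy hu0) hz hρ0 (by rw [hρ2]; linarith), hρ2]
    have : 0 ≤ tiltG y z s c u := hG.le
    unfold tiltG at this; linarith
  -- slack: `(1+η) u^c < u^κ`
  have hcκ' : u ^ c < u ^ κ := Real.rpow_lt_rpow_of_exponent_lt hu1 hcκ
  have huc0 : 0 < u ^ c := Real.rpow_pos_of_pos hu0 c
  refine ⟨u, (u ^ κ / u ^ c - 1) / 2, hu1, by
    have : 1 < u ^ κ / u ^ c := (one_lt_div huc0).2 hcκ'; linarith, ?_⟩
  have hq : (1 + (u ^ κ / u ^ c - 1) / 2) * u ^ c < u ^ κ := by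
    have e : (1 + (u ^ κ / u ^ c - 1) / 2) * u ^ c = (u ^ c + u ^ κ) / 2 := by field_simp; ring
    rw [e]; linarith
  calc stripMuY₂ 1 (y * u) z * (1 + (u ^ κ / u ^ c - 1) / 2)
      ≤ ρ * (1 + (u ^ κ / u ^ c - 1) / 2) := by
        apply mul_le_mul_of_nonneg_right hle
        have : 1 < u ^ κ / u ^ c := (one_lt_div huc0).2 hcκ'; linarith
    _ = μ * ((1 + (u ^ κ / u ^ c - 1) / 2) * u ^ c) := by rw [hρ]; ring
    _ < μ * u ^ κ := mul_lt_mul_of_pos_left hq hμ0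

/-- ★★ **Lower tilt**: for `κ < b(y,z)` there are `0 < u < 1` and `η > 0` with `μ_1(yu,z)(1+η) < μ_1(y,z) u^κ`.
[cite: BeatonBousquetMelouDeGierDuminilCopinGuttmann2014, §3.2 Proposition 6 (arXiv v5 p. 10); MadrasSlade1993, §1.2] -/
theorem exists_contactTilt_lt (hy : 0 < y) (hz : 0 < z) {κ : ℝ} (hκ : κ < contactB y z) :
    ∃ u η : ℝ, 0 < u ∧ u < 1 ∧ 0 < η ∧ stripMuY₂ 1 (y * u) z * (1 + η) < stripMuY₂ 1 y z * u ^ κ := by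
  obtain ⟨hys, hzs, hF, hsex, hb0, -⟩ := contactB_facts hy hz
  set μ := stripMuY₂ 1 y z with hμ
  have hμ0 : 0 < μ := stripMuY₂_pos 1 hy hz
  set s := μ ^ 2 with hs
  have hs0 : 0 < s := by positivity
  set c := (contactB y z + κ) / 2 with hc
  have hcb : c < contactB y z := by rw [hc]; linarith
  have hcκ : κ < c := by rw [hc]; linarith
  have hder : 2 * c * s * sexticDeriv y z s - y * (s * (s - z) + z) < 0 := by
    have e : y * (s * (s - z) + z) = s * (s * (s - z)) := by linear_combination (-1 : ℝ) * hsex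
    rw [e]
    have : 2 * c * sexticDeriv y z s < s * (s - z) := by
      have h := hcb; unfold contactB at h; rw [← hμ, ← hs, lt_div_iff₀ (by positivity)] at h; linarith
    nlinarith
  have h0 : tiltG y z s c 1 = 0 := by rw [tiltG_one]; linarith
  have hev1 := (tiltG_eventually_pos y z s c h0).2 hder
  have hev2 : ∀ᶠ u in 𝓝[<] (1 : ℝ), u < 1 := eventually_mem_nhdsWithin
  have hev2' : ∀ᶠ u in 𝓝[<] (1 : ℝ), 0 < u := (lt_mem_nhds zero_lt_one).filter_mono nhdsWithin_le_nhds
  have hcont : ContinuousAt (fun u : ℝ => s * u ^ (2 * c) - max (y * u) z) 1 :=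
    (continuousAt_const.mul (Real.continuousAt_rpow_const _ _ (Or.inl one_ne_zero))).sub
      ((continuousAt_const.mul continuousAt_id).max continuousAt_const)
  have hat1 : 0 < s * (1 : ℝ) ^ (2 * c) - max (y * 1) z := by
    rw [Real.one_rpow, mul_one, mul_one]; exact sub_pos.2 (max_lt hys hzs)
  have hev3 : ∀ᶠ u in 𝓝[<] (1 : ℝ), 0 < s * u ^ (2 * c) - max (y * u) z :=
    (hcont.eventually (lt_mem_nhds hat1)).filter_mono nhdsWithin_le_nhds
  obtain ⟨u, hG, hu1, hu0, hm⟩ := (hev1.and (hev2.and (hev2'.and hev3))).exists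
  set ρ := μ * u ^ c with hρ
  have hρ0 : 0 < ρ := mul_pos hμ0 (Real.rpow_pos_of_pos hu0 c)
  have hρ2 : ρ ^ 2 = s * u ^ (2 * c) := by
    rw [hρ, mul_pow, hs, ← Real.rpow_natCast (u ^ c) 2, ← Real.rpow_mul hu0.le]; push_cast; ring_nf
  have hle : stripMuY₂ 1 (y * u) z ≤ ρ := by
    rw [stripMuY₂_one_le_iff (mul_pos hy hu0) hz hρ0 (by rw [hρ2]; linarith), hρ2]
    have : 0 ≤ tiltG y z s c u := hG.le
    unfold tiltG at this; linarith
  have hcκ' : u ^ c < u ^ κ := Real.rpow_lt_rpow_of_exponent_gt hu0 hu1 hcκ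
  have huc0 : 0 < u ^ c := Real.rpow_pos_of_pos hu0 c
  refine ⟨u, (u ^ κ / u ^ c - 1) / 2, hu0, hu1, by
    have : 1 < u ^ κ / u ^ c := (one_lt_div huc0).2 hcκ'; linarith, ?_⟩
  have hq : (1 + (u ^ κ / u ^ c - 1) / 2) * u ^ c < u ^ κ := by
    have e : (1 + (u ^ κ / u ^ c - 1) / 2) * u ^ c = (u ^ c + u ^ κ) / 2 := by field_simp; ring
    rw [e]; linarith
  calc stripMuY₂ 1 (y * u) z * (1 + (u ^ κ / u ^ c - 1) / 2)
      ≤ ρ * (1 + (u ^ κ / u ^ c - 1) / 2) := by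
        apply mul_le_mul_of_nonneg_right hle
        have : 1 < u ^ κ / u ^ c := (one_lt_div huc0).2 hcκ'; linarith
    _ = μ * ((1 + (u ^ κ / u ^ c - 1) / 2) * u ^ c) := by rw [hρ]; ring
    _ < μ * u ^ κ := mul_lt_mul_of_pos_left hq hμ0

/-! ## §4 Chernoff at the level of walks: tilting the bottom fugacity `y ↦ yu` -/

/-- ★ **The tilt identity**: `wgt (yu) z = wgt y z · u^{bc}`. [cite: BeatonBousquetMelouDeGierDuminilCopinGuttmann2014, §3.2 (arXiv v5 p. 10)] -/
theorem wgt_tilt (y z u : ℝ) (N : ℕ) (q : Site 2 × (ℕ → Site 2)) :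
    wgt (y * u) z N q = wgt y z N q * u ^ bottomVisits₀ q.1 q.2 N := by
  unfold wgt; rw [mul_pow]; ring

open Classical in
/-- ★★ **Chernoff, upper tail of the bottom contacts**: for `u ≥ 1`,
`(Σ_{q : κN ≤ bc(q)} y^{bc} z^{tc}) · u^{κN} ≤ C_{1,N}(yu, z)`. [cite: BeatonBousquetMelouDeGierDuminilCopinGuttmann2014, §3.2 (arXiv v5 p. 10); MadrasSlade1993, §1.2 (elementary)] -/
theorem sum_contacts_ge_mul_rpow_le (hy : 0 ≤ y) (hz : 0 ≤ z) {u : ℝ} (hu : 1 ≤ u) (N : ℕ) (κ : ℝ) :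
    (∑ q ∈ (stripPairs 1 N).filter (fun q => κ * N ≤ (bottomVisits₀ q.1 q.2 N : ℝ)), wgt y z N q) * u ^ (κ * N) ≤
      stripZ₂ 1 N (y * u) z := by
  have hu0 : 0 ≤ u := zero_le_one.trans hu
  rw [Finset.sum_mul, stripZ₂_one_eq_sum_wgt]
  calc ∑ q ∈ (stripPairs 1 N).filter (fun q => κ * N ≤ (bottomVisits₀ q.1 q.2 N : ℝ)), wgt y z N q * u ^ (κ * N)
      ≤ ∑ q ∈ (stripPairs 1 N).filter (fun q => κ * N ≤ (bottomVisits₀ q.1 q.2 N : ℝ)), wgt (y * u) z N q :=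
        Finset.sum_le_sum fun q hq => by
          rw [wgt_tilt]
          refine mul_le_mul_of_nonneg_left ?_ (wgt_nonneg hy hz N q)
          calc u ^ (κ * N) ≤ u ^ ((bottomVisits₀ q.1 q.2 N : ℕ) : ℝ) :=
                Real.rpow_le_rpow_of_exponent_le hu (Finset.mem_filter.1 hq).2
            _ = u ^ bottomVisits₀ q.1 q.2 N := Real.rpow_natCast u _
    _ ≤ ∑ q ∈ stripPairs 1 N, wgt (y * u) z N q :=
        Finset.sum_le_sum_of_subset_of_nonneg (Finset.filter_subset _ _) fun q _ _ =>
          wgt_nonneg (mul_nonneg hy hu0) hz N q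

open Classical in
/-- ★★ **Chernoff, lower tail of the bottom contacts**: for `0 < u ≤ 1`,
`(Σ_{q : bc(q) ≤ κN} y^{bc} z^{tc}) · u^{κN} ≤ C_{1,N}(yu, z)`. [cite: BeatonBousquetMelouDeGierDuminilCopinGuttmann2014, §3.2 (arXiv v5 p. 10); MadrasSlade1993, §1.2 (elementary)] -/
theorem sum_contacts_le_mul_rpow_le (hy : 0 ≤ y) (hz : 0 ≤ z) {u : ℝ} (hu0 : 0 < u) (hu1 : u ≤ 1) (N : ℕ) (κ : ℝ) :
    (∑ q ∈ (stripPairs 1 N).filter (fun q => (bottomVisits₀ q.1 q.2 N : ℝ) ≤ κ * N), wgt y z N q) * u ^ (κ * N) ≤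
      stripZ₂ 1 N (y * u) z := by
  rw [Finset.sum_mul, stripZ₂_one_eq_sum_wgt]
  calc ∑ q ∈ (stripPairs 1 N).filter (fun q => (bottomVisits₀ q.1 q.2 N : ℝ) ≤ κ * N), wgt y z N q * u ^ (κ * N)
      ≤ ∑ q ∈ (stripPairs 1 N).filter (fun q => (bottomVisits₀ q.1 q.2 N : ℝ) ≤ κ * N), wgt (y * u) z N q :=
        Finset.sum_le_sum fun q hq => by
          rw [wgt_tilt]
          refine mul_le_mul_of_nonneg_left ?_ (wgt_nonneg hy hz N q)
          calc u ^ (κ * N) ≤ u ^ ((bottomVisits₀ q.1 q.2 N : ℕ) : ℝ) :=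
                Real.rpow_le_rpow_of_exponent_ge hu0 hu1 (Finset.mem_filter.1 hq).2
            _ = u ^ bottomVisits₀ q.1 q.2 N := Real.rpow_natCast u _
    _ ≤ ∑ q ∈ stripPairs 1 N, wgt (y * u) z N q :=
        Finset.sum_le_sum_of_subset_of_nonneg (Finset.filter_subset _ _) fun q _ _ =>
          wgt_nonneg (mul_nonneg hy hu0.le) hz N q

/-- **From a tilt to a geometric bound on a fraction** (eventually in `N`): if `m_N · u^{κN} ≤ C_{1,N}(yu,z)` and
`μ_1(yu,z)(1+η) < μ_1(y,z) u^κ`, then `m_N / C_{1,N}(y,z) ≤ K(y)K(z) θ^N` eventually, `θ = μ_1(yu,z)(1+η)/(μ_1(y,z)u^κ) < 1`.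
[cite: BeatonBousquetMelouDeGierDuminilCopinGuttmann2014, §3.2 Proposition 6 (arXiv v5 p. 10); AlmJanson1990, via MadrasSlade1993 §8.5 pp. 278–279] -/
theorem fraction_le_geometric_of_tilt (hy : 0 < y) (hz : 0 < z) {u η κ : ℝ} (hu0 : 0 < u) (hη : 0 < η)
    (htilt : stripMuY₂ 1 (y * u) z * (1 + η) < stripMuY₂ 1 y z * u ^ κ) (m : ℕ → ℝ)
    (hm : ∀ N, m N * u ^ (κ * N) ≤ stripZ₂ 1 N (y * u) z) :
    ∃ C θ : ℝ, 0 ≤ C ∧ 0 ≤ θ ∧ θ < 1 ∧ ∀ᶠ N : ℕ in atTop, m N / stripZ₂ 1 N y z ≤ C * θ ^ N := by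
  have hyu : 0 < y * u := mul_pos hy hu0
  have hμ := stripMuY₂_pos 1 hy hz
  have hμ' := stripMuY₂_pos 1 hyu hz
  have huκ : 0 < u ^ κ := Real.rpow_pos_of_pos hu0 κ
  set θ := stripMuY₂ 1 (y * u) z * (1 + η) / (stripMuY₂ 1 y z * u ^ κ) with hθ
  have hden : 0 < stripMuY₂ 1 y z * u ^ κ := mul_pos hμ huκ
  have hθ0 : 0 ≤ θ := div_nonneg (by positivity) hden.le
  have hθ1 : θ < 1 := (div_lt_one hden).2 htilt
  refine ⟨yK y * yK z, θ, by have := one_le_yK y; have := one_le_yK z; positivity, hθ0, hθ1, ?_⟩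
  filter_upwards [eventually_stripZ₂_one_le_pow₂ hyu hz hη, Filter.eventually_gt_atTop 0] with N hZ hN
  have hN0 : N ≠ 0 := by omega
  have hZpos := stripZ₂_pos 1 N hy hz
  have hK := stripMuY₂_one_pow_le hy hz hN0  -- μ^N ≤ K K Z_N(y,z)
  have hKpos : 0 < yK y * yK z := by have := one_le_yK y; have := one_le_yK z; positivity
  -- `m_N ≤ Z_N(yu,z) / u^{κN} ≤ (μ' (1+η))^N / (u^κ)^N`
  have hupow : u ^ (κ * N) = (u ^ κ) ^ N := by rw [Real.rpow_mul_natCast hu0.le]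
  have hm1 : m N ≤ (stripMuY₂ 1 (y * u) z * (1 + η)) ^ N / (u ^ κ) ^ N := by
    rw [le_div_iff₀ (pow_pos huκ N), ← hupow]; exact (hm N).trans hZ
  have hZ' : 1 / stripZ₂ 1 N y z ≤ (yK y * yK z) / stripMuY₂ 1 y z ^ N := by
    rw [div_le_div_iff₀ hZpos (pow_pos hμ N)]; linarith
  calc m N / stripZ₂ 1 N y z = m N * (1 / stripZ₂ 1 N y z) := by ring
    _ ≤ ((stripMuY₂ 1 (y * u) z * (1 + η)) ^ N / (u ^ κ) ^ N) * ((yK y * yK z) / stripMuY₂ 1 y z ^ N) :=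
        mul_le_mul hm1 hZ' (by positivity) (by positivity)
    _ = yK y * yK z * θ ^ N := by rw [hθ, div_pow, mul_pow, mul_pow]; field_simp

/-! ## §5 Exponential tails and the law of large numbers for the bottom contacts -/

open Classical in
/-- ★★★ **UPPER TAIL OF THE BOTTOM CONTACTS**: for `y, z > 0` and `κ > b(y,z)` there are `C, θ < 1` with
`P_{N,y,z}(bc(ω) ≥ κN) ≤ C θ^N` for all large `N`. [cite: BeatonBousquetMelouDeGierDuminilCopinGuttmann2014, §3.2 Proposition 6 (arXiv v5 p. 10); AlmJanson1990, via MadrasSlade1993 §8.5 pp. 278–279] -/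
theorem contacts_ge_fraction_le (hy : 0 < y) (hz : 0 < z) {κ : ℝ} (hκ : contactB y z < κ) :
    ∃ C θ : ℝ, 0 ≤ C ∧ 0 ≤ θ ∧ θ < 1 ∧ ∀ᶠ N : ℕ in atTop,
      (∑ q ∈ (stripPairs 1 N).filter (fun q => κ * N ≤ (bottomVisits₀ q.1 q.2 N : ℝ)), wgt y z N q) /
        stripZ₂ 1 N y z ≤ C * θ ^ N := by
  classical
  obtain ⟨u, η, hu1, hη, htilt⟩ := exists_contactTilt_gt hy hz hκ
  exact fraction_le_geometric_of_tilt hy hz (zero_lt_one.trans hu1) hη htilt _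
    (fun N => sum_contacts_ge_mul_rpow_le hy.le hz.le hu1.le N κ)

open Classical in
/-- ★★★ **LOWER TAIL OF THE BOTTOM CONTACTS** (`κ < b(y,z)`). [cite: BeatonBousquetMelouDeGierDuminilCopinGuttmann2014, §3.2 Proposition 6 (arXiv v5 p. 10); AlmJanson1990, via MadrasSlade1993 §8.5 pp. 278–279] -/
theorem contacts_le_fraction_le (hy : 0 < y) (hz : 0 < z) {κ : ℝ} (hκ : κ < contactB y z) :
    ∃ C θ : ℝ, 0 ≤ C ∧ 0 ≤ θ ∧ θ < 1 ∧ ∀ᶠ N : ℕ in atTop,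
      (∑ q ∈ (stripPairs 1 N).filter (fun q => (bottomVisits₀ q.1 q.2 N : ℝ) ≤ κ * N), wgt y z N q) /
        stripZ₂ 1 N y z ≤ C * θ ^ N := by
  classical
  obtain ⟨u, η, hu0, hu1, hη, htilt⟩ := exists_contactTilt_lt hy hz hκ
  exact fraction_le_geometric_of_tilt hy hz hu0 hη htilt _
    (fun N => sum_contacts_le_mul_rpow_le hy.le hz.le hu0 hu1.le N κ)

open Classical in
/-- The walks whose bottom-contact density deviates from `b(y,z)` by at least `ε`.
[cite: BeatonBousquetMelouDeGierDuminilCopinGuttmann2014, §3.2 (arXiv v5 p. 10)] -/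
def contactDevPairs (y z : ℝ) (N : ℕ) (ε : ℝ) : Finset (Site 2 × (ℕ → Site 2)) :=
  (stripPairs 1 N).filter fun q => ε ≤ |(bottomVisits₀ q.1 q.2 N : ℝ) / N - contactB y z|

open Classical in
/-- ★★★ **THE CONTACT DENSITY LAW**: under `P_{N,y,z} ∝ y^{bc} z^{tc}` on the `N`-step SAWs of the one-cell strip,
`bc(ω)/N → b(y,z)` in probability, for every `y, z > 0`: `P_{N,y,z}(|bc(ω)/N − b(y,z)| ≥ ε) → 0`.
[cite: BeatonBousquetMelouDeGierDuminilCopinGuttmann2014, §3.2 Proposition 6 (arXiv v5 p. 10); AlmJanson1990, via MadrasSlade1993 §8.5 pp. 278–279] -/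
theorem tendsto_contactDevFraction (hy : 0 < y) (hz : 0 < z) {ε : ℝ} (hε : 0 < ε) :
    Tendsto (fun N => (∑ q ∈ contactDevPairs y z N ε, wgt y z N q) / stripZ₂ 1 N y z) atTop (𝓝 0) := by
  classical
  set b := contactB y z with hb
  obtain ⟨C₁, θ₁, hC₁, hθ₁, hθ₁1, h₁⟩ := contacts_ge_fraction_le hy hz (κ := b + ε) (by linarith)
  obtain ⟨C₂, θ₂, hC₂, hθ₂, hθ₂1, h₂⟩ := contacts_le_fraction_le hy hz (κ := b - ε) (by linarith)
  have hlim : Tendsto (fun N : ℕ => C₁ * θ₁ ^ N + C₂ * θ₂ ^ N) atTop (𝓝 0) := by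
    have := ((tendsto_pow_atTop_nhds_zero_of_lt_one hθ₁ hθ₁1).const_mul C₁).add
      ((tendsto_pow_atTop_nhds_zero_of_lt_one hθ₂ hθ₂1).const_mul C₂)
    simpa using this
  have hZ : ∀ N, 0 < stripZ₂ 1 N y z := fun N => stripZ₂_pos 1 N hy hz
  refine squeeze_zero' (Eventually.of_forall fun N => div_nonneg
    (Finset.sum_nonneg fun q _ => wgt_nonneg hy.le hz.le N q) (hZ N).le) ?_ hlim
  filter_upwards [h₁, h₂, eventually_ge_atTop 1] with N hA hB hN
  have hN' : (0 : ℝ) < N := by exact_mod_cast hN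
  have hsub : contactDevPairs y z N ε ⊆
      ((stripPairs 1 N).filter fun q => (b + ε) * N ≤ (bottomVisits₀ q.1 q.2 N : ℝ)) ∪
      ((stripPairs 1 N).filter fun q => (bottomVisits₀ q.1 q.2 N : ℝ) ≤ (b - ε) * N) := by
    intro q hq
    rw [contactDevPairs, Finset.mem_filter] at hq
    obtain ⟨hq, hdev⟩ := hq
    rw [Finset.mem_union, Finset.mem_filter, Finset.mem_filter]
    rcases le_abs'.1 hdev with h | h
    · right; refine ⟨hq, ?_⟩
      have h' : (bottomVisits₀ q.1 q.2 N : ℝ) / N ≤ b - ε := by linarith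
      rwa [div_le_iff₀ hN'] at h'
    · left; refine ⟨hq, ?_⟩
      have h' : b + ε ≤ (bottomVisits₀ q.1 q.2 N : ℝ) / N := by linarith
      rwa [le_div_iff₀ hN'] at h'
  calc (∑ q ∈ contactDevPairs y z N ε, wgt y z N q) / stripZ₂ 1 N y z
      ≤ ((∑ q ∈ (stripPairs 1 N).filter (fun q => (b + ε) * N ≤ (bottomVisits₀ q.1 q.2 N : ℝ)), wgt y z N q) +
          (∑ q ∈ (stripPairs 1 N).filter (fun q => (bottomVisits₀ q.1 q.2 N : ℝ) ≤ (b - ε) * N), wgt y z N q)) /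
          stripZ₂ 1 N y z := by
        gcongr
        · exact (hZ N).le
        calc ∑ q ∈ contactDevPairs y z N ε, wgt y z N q
            ≤ ∑ q ∈ ((stripPairs 1 N).filter fun q => (b + ε) * N ≤ (bottomVisits₀ q.1 q.2 N : ℝ)) ∪
                ((stripPairs 1 N).filter fun q => (bottomVisits₀ q.1 q.2 N : ℝ) ≤ (b - ε) * N), wgt y z N q :=
              Finset.sum_le_sum_of_subset_of_nonneg hsub fun q _ _ => wgt_nonneg hy.le hz.le N q
          _ ≤ _ := by
              rw [← Finset.sum_union_inter]
              linarith [Finset.sum_nonneg (s := ((stripPairs 1 N).filter fun q => (b + ε) * N ≤ (bottomVisits₀ q.1 q.2 N : ℝ)) ∩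
                ((stripPairs 1 N).filter fun q => (bottomVisits₀ q.1 q.2 N : ℝ) ≤ (b - ε) * N))
                (fun q _ => wgt_nonneg hy.le hz.le N q)]
    _ = _ := add_div _ _ _
    _ ≤ C₁ * θ₁ ^ N + C₂ * θ₂ ^ N := add_le_add hA hB

/-- **The mean number of bottom contacts under `P_{N,y,z}`**. [cite: BeatonBousquetMelouDeGierDuminilCopinGuttmann2014, §3.2 (arXiv v5 p. 10)] -/
def meanContacts (y z : ℝ) (N : ℕ) : ℝ := (∑ q ∈ stripPairs 1 N, wgt y z N q * (bottomVisits₀ q.1 q.2 N : ℝ)) / stripZ₂ 1 N y z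

open Classical in
/-- ★★★ **THE MEAN CONTACT DENSITY**: `⟨bc(ω)⟩_{N,y,z} / N → b(y,z)` for every `y, z > 0`.
[cite: BeatonBousquetMelouDeGierDuminilCopinGuttmann2014, §3.2 Proposition 6 (arXiv v5 p. 10); AlmJanson1990, via MadrasSlade1993 §8.5 pp. 278–279] -/
theorem tendsto_meanContacts_div (hy : 0 < y) (hz : 0 < z) :
    Tendsto (fun N : ℕ => meanContacts y z N / N) atTop (𝓝 (contactB y z)) := by
  classical
  set b := contactB y z with hb
  obtain ⟨-, -, -, -, hb0, hb1⟩ := contactB_facts hy hz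
  have hZ : ∀ N, 0 < stripZ₂ 1 N y z := fun N => stripZ₂_pos 1 N hy hz
  rw [Metric.tendsto_atTop]
  intro η hη
  have h1 : ∀ᶠ N : ℕ in atTop, (∑ q ∈ contactDevPairs y z N (η / 2), wgt y z N q) / stripZ₂ 1 N y z < η / 6 :=
    (tendsto_contactDevFraction hy hz (by positivity : 0 < η / 2)).eventually (gt_mem_nhds (by positivity))
  obtain ⟨N₀, hN₀⟩ := Filter.eventually_atTop.1 (h1.and (eventually_ge_atTop 1))
  refine ⟨N₀, fun N hN => ?_⟩
  obtain ⟨hA, hN1⟩ := hN₀ N hN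
  have hN' : (0 : ℝ) < N := by exact_mod_cast hN1
  have hN1' : (1 : ℝ) ≤ N := by exact_mod_cast hN1
  rw [Real.dist_eq]
  -- termwise: `f_q = bc/N ∈ [0, 2]`, `|f_q − b| ≤ η/2 + 3·[q ∈ dev]`
  have hterm : ∀ q ∈ stripPairs 1 N, wgt y z N q * |(bottomVisits₀ q.1 q.2 N : ℝ) / N - b| ≤
      wgt y z N q * (η / 2) + 3 * (if q ∈ contactDevPairs y z N (η / 2) then wgt y z N q else 0) := by
    intro q hq
    have hw := wgt_nonneg hy.le hz.le N q
    have hf0 : 0 ≤ (bottomVisits₀ q.1 q.2 N : ℝ) / N := by positivity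
    have hf2 : (bottomVisits₀ q.1 q.2 N : ℝ) / N ≤ 2 := by
      rw [div_le_iff₀ hN']
      have : (bottomVisits₀ q.1 q.2 N : ℝ) ≤ N + 1 := by exact_mod_cast bottomVisits₀_le q.1 q.2 N
      linarith
    split_ifs with h
    · have : |(bottomVisits₀ q.1 q.2 N : ℝ) / N - b| ≤ 3 := by rw [abs_le]; constructor <;> linarith
      nlinarith
    · have hsmall : |(bottomVisits₀ q.1 q.2 N : ℝ) / N - b| < η / 2 := by
        by_contra hcon
        exact h (by rw [contactDevPairs, Finset.mem_filter]; exact ⟨hq, not_lt.1 hcon⟩)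
      nlinarith
  have hsum : ∑ q ∈ stripPairs 1 N, wgt y z N q * ((bottomVisits₀ q.1 q.2 N : ℝ) / N - b) =
      (∑ q ∈ stripPairs 1 N, wgt y z N q * (bottomVisits₀ q.1 q.2 N : ℝ)) / N - b * stripZ₂ 1 N y z := by
    rw [stripZ₂_one_eq_sum_wgt, Finset.mul_sum, Finset.sum_div, ← Finset.sum_sub_distrib]
    exact Finset.sum_congr rfl fun q _ => by ring
  have e : meanContacts y z N / N - b = (∑ q ∈ stripPairs 1 N, wgt y z N q * ((bottomVisits₀ q.1 q.2 N : ℝ) / N - b)) /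
      stripZ₂ 1 N y z := by
    rw [hsum, meanContacts]
    have hZ' := (hZ N).ne'
    field_simp
  rw [e, abs_div, abs_of_pos (hZ N), div_lt_iff₀ (hZ N)]
  calc |∑ q ∈ stripPairs 1 N, wgt y z N q * ((bottomVisits₀ q.1 q.2 N : ℝ) / N - b)|
      ≤ ∑ q ∈ stripPairs 1 N, |wgt y z N q * ((bottomVisits₀ q.1 q.2 N : ℝ) / N - b)| := Finset.abs_sum_le_sum_abs _ _
    _ = ∑ q ∈ stripPairs 1 N, wgt y z N q * |(bottomVisits₀ q.1 q.2 N : ℝ) / N - b| :=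
        Finset.sum_congr rfl fun q _ => by rw [abs_mul, abs_of_nonneg (wgt_nonneg hy.le hz.le N q)]
    _ ≤ ∑ q ∈ stripPairs 1 N, (wgt y z N q * (η / 2) + 3 * (if q ∈ contactDevPairs y z N (η / 2) then wgt y z N q else 0)) :=
        Finset.sum_le_sum hterm
    _ = (η / 2) * stripZ₂ 1 N y z + 3 * ∑ q ∈ contactDevPairs y z N (η / 2), wgt y z N q := by
        rw [Finset.sum_add_distrib, ← Finset.sum_mul, stripZ₂_one_eq_sum_wgt, ← Finset.mul_sum, Finset.sum_ite_mem, mul_comm]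
        congr 3
        exact Finset.inter_eq_right.2 (show contactDevPairs y z N (η / 2) ⊆ stripPairs 1 N from Finset.filter_subset _ _)
    _ < (η / 2) * stripZ₂ 1 N y z + 3 * ((η / 6) * stripZ₂ 1 N y z) := by
        have := (div_lt_iff₀ (hZ N)).1 hA; nlinarith [hZ N]
    _ = η * stripZ₂ 1 N y z := by ring

/-! ## §6 The top contacts (tilting `z`; `μ_1(y, zu) = μ_1(zu, y)`) -/

/-- The tilt identity for the top fugacity. [cite: BeatonBousquetMelouDeGierDuminilCopinGuttmann2014, §3.2 (arXiv v5 p. 10)] -/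
theorem wgt_tilt_top (y z u : ℝ) (N : ℕ) (q : Site 2 × (ℕ → Site 2)) :
    wgt y (z * u) N q = wgt y z N q * u ^ topVisits₀ 1 q.1 q.2 N := by
  unfold wgt; rw [mul_pow]; ring

open Classical in
/-- Chernoff, upper tail of the top contacts (`u ≥ 1`). [cite: BeatonBousquetMelouDeGierDuminilCopinGuttmann2014, §3.2 (arXiv v5 p. 10); MadrasSlade1993, §1.2 (elementary)] -/
theorem sum_topContacts_ge_mul_rpow_le (hy : 0 ≤ y) (hz : 0 ≤ z) {u : ℝ} (hu : 1 ≤ u) (N : ℕ) (κ : ℝ) :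
    (∑ q ∈ (stripPairs 1 N).filter (fun q => κ * N ≤ (topVisits₀ 1 q.1 q.2 N : ℝ)), wgt y z N q) * u ^ (κ * N) ≤
      stripZ₂ 1 N y (z * u) := by
  have hu0 : 0 ≤ u := zero_le_one.trans hu
  rw [Finset.sum_mul, stripZ₂_one_eq_sum_wgt]
  calc ∑ q ∈ (stripPairs 1 N).filter (fun q => κ * N ≤ (topVisits₀ 1 q.1 q.2 N : ℝ)), wgt y z N q * u ^ (κ * N)
      ≤ ∑ q ∈ (stripPairs 1 N).filter (fun q => κ * N ≤ (topVisits₀ 1 q.1 q.2 N : ℝ)), wgt y (z * u) N q :=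
        Finset.sum_le_sum fun q hq => by
          rw [wgt_tilt_top]
          refine mul_le_mul_of_nonneg_left ?_ (wgt_nonneg hy hz N q)
          calc u ^ (κ * N) ≤ u ^ ((topVisits₀ 1 q.1 q.2 N : ℕ) : ℝ) :=
                Real.rpow_le_rpow_of_exponent_le hu (Finset.mem_filter.1 hq).2
            _ = u ^ topVisits₀ 1 q.1 q.2 N := Real.rpow_natCast u _
    _ ≤ ∑ q ∈ stripPairs 1 N, wgt y (z * u) N q :=
        Finset.sum_le_sum_of_subset_of_nonneg (Finset.filter_subset _ _) fun q _ _ =>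
          wgt_nonneg hy (mul_nonneg hz hu0) N q

open Classical in
/-- Chernoff, lower tail of the top contacts (`0 < u ≤ 1`). [cite: BeatonBousquetMelouDeGierDuminilCopinGuttmann2014, §3.2 (arXiv v5 p. 10); MadrasSlade1993, §1.2 (elementary)] -/
theorem sum_topContacts_le_mul_rpow_le (hy : 0 ≤ y) (hz : 0 ≤ z) {u : ℝ} (hu0 : 0 < u) (hu1 : u ≤ 1) (N : ℕ) (κ : ℝ) :
    (∑ q ∈ (stripPairs 1 N).filter (fun q => (topVisits₀ 1 q.1 q.2 N : ℝ) ≤ κ * N), wgt y z N q) * u ^ (κ * N) ≤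
      stripZ₂ 1 N y (z * u) := by
  rw [Finset.sum_mul, stripZ₂_one_eq_sum_wgt]
  calc ∑ q ∈ (stripPairs 1 N).filter (fun q => (topVisits₀ 1 q.1 q.2 N : ℝ) ≤ κ * N), wgt y z N q * u ^ (κ * N)
      ≤ ∑ q ∈ (stripPairs 1 N).filter (fun q => (topVisits₀ 1 q.1 q.2 N : ℝ) ≤ κ * N), wgt y (z * u) N q :=
        Finset.sum_le_sum fun q hq => by
          rw [wgt_tilt_top]
          refine mul_le_mul_of_nonneg_left ?_ (wgt_nonneg hy hz N q)
          calc u ^ (κ * N) ≤ u ^ ((topVisits₀ 1 q.1 q.2 N : ℕ) : ℝ) :=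
                Real.rpow_le_rpow_of_exponent_ge hu0 hu1 (Finset.mem_filter.1 hq).2
            _ = u ^ topVisits₀ 1 q.1 q.2 N := Real.rpow_natCast u _
    _ ≤ ∑ q ∈ stripPairs 1 N, wgt y (z * u) N q :=
        Finset.sum_le_sum_of_subset_of_nonneg (Finset.filter_subset _ _) fun q _ _ =>
          wgt_nonneg hy (mul_nonneg hz hu0.le) N q

/-- The geometric bound for a `z`-tilt (same as `fraction_le_geometric_of_tilt` with the roles of the fugacities
exchanged via `μ_1(y, zu) = μ_1(zu, y)`). [cite: BeatonBousquetMelouDeGierDuminilCopinGuttmann2014, Proposition 6 (arXiv v5 p. 10: μ_T(y,z) symmetric); AlmJanson1990, via MadrasSlade1993 §8.5 pp. 278–279] -/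
theorem fraction_le_geometric_of_tilt_top (hy : 0 < y) (hz : 0 < z) {u η κ : ℝ} (hu0 : 0 < u) (hη : 0 < η)
    (htilt : stripMuY₂ 1 (z * u) y * (1 + η) < stripMuY₂ 1 z y * u ^ κ) (m : ℕ → ℝ)
    (hm : ∀ N, m N * u ^ (κ * N) ≤ stripZ₂ 1 N y (z * u)) :
    ∃ C θ : ℝ, 0 ≤ C ∧ 0 ≤ θ ∧ θ < 1 ∧ ∀ᶠ N : ℕ in atTop, m N / stripZ₂ 1 N y z ≤ C * θ ^ N := by
  have hzu : 0 < z * u := mul_pos hz hu0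
  have hμ := stripMuY₂_pos 1 hy hz
  have huκ : 0 < u ^ κ := Real.rpow_pos_of_pos hu0 κ
  rw [stripMuY₂_symm 1 (z * u) y, stripMuY₂_symm 1 z y] at htilt
  set θ := stripMuY₂ 1 y (z * u) * (1 + η) / (stripMuY₂ 1 y z * u ^ κ) with hθ
  have hden : 0 < stripMuY₂ 1 y z * u ^ κ := mul_pos hμ huκ
  have hθ0 : 0 ≤ θ := div_nonneg (by have := stripMuY₂_pos 1 hy hzu; positivity) hden.le
  have hθ1 : θ < 1 := (div_lt_one hden).2 htilt
  refine ⟨yK y * yK z, θ, by have := one_le_yK y; have := one_le_yK z; positivity, hθ0, hθ1, ?_⟩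
  filter_upwards [eventually_stripZ₂_one_le_pow₂ hy hzu hη, Filter.eventually_gt_atTop 0] with N hZ hN
  have hN0 : N ≠ 0 := by omega
  have hZpos := stripZ₂_pos 1 N hy hz
  have hK := stripMuY₂_one_pow_le hy hz hN0
  have hupow : u ^ (κ * N) = (u ^ κ) ^ N := by rw [Real.rpow_mul_natCast hu0.le]
  have hm1 : m N ≤ (stripMuY₂ 1 y (z * u) * (1 + η)) ^ N / (u ^ κ) ^ N := by
    rw [le_div_iff₀ (pow_pos huκ N), ← hupow]; exact (hm N).trans hZ
  have hZ' : 1 / stripZ₂ 1 N y z ≤ (yK y * yK z) / stripMuY₂ 1 y z ^ N := by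
    rw [div_le_div_iff₀ hZpos (pow_pos hμ N)]; linarith
  calc m N / stripZ₂ 1 N y z = m N * (1 / stripZ₂ 1 N y z) := by ring
    _ ≤ ((stripMuY₂ 1 y (z * u) * (1 + η)) ^ N / (u ^ κ) ^ N) * ((yK y * yK z) / stripMuY₂ 1 y z ^ N) :=
        mul_le_mul hm1 hZ' (by positivity) (by have := stripMuY₂_pos 1 hy hzu; positivity)
    _ = yK y * yK z * θ ^ N := by rw [hθ, div_pow, mul_pow, mul_pow]; field_simp

open Classical in
/-- ★★★ **THE TOP CONTACT DENSITY**: `P_{N,y,z}(|tc(ω)/N − b(z,y)| ≥ ε) → 0` for every `y, z > 0`, `ε > 0`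
(`b(z,y) = s(s−y)/(2F_{y,z}(s))`, `contactB_swap`). [cite: BeatonBousquetMelouDeGierDuminilCopinGuttmann2014, §3.2 Proposition 6 (arXiv v5 p. 10); AlmJanson1990, via MadrasSlade1993 §8.5 pp. 278–279] -/
theorem tendsto_topContactDevFraction (hy : 0 < y) (hz : 0 < z) {ε : ℝ} (hε : 0 < ε) :
    Tendsto (fun N => (∑ q ∈ (stripPairs 1 N).filter (fun q => ε ≤ |(topVisits₀ 1 q.1 q.2 N : ℝ) / N - contactB z y|),
      wgt y z N q) / stripZ₂ 1 N y z) atTop (𝓝 0) := by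
  classical
  set b := contactB z y with hb
  obtain ⟨u₁, η₁, hu₁, hη₁, ht₁⟩ := exists_contactTilt_gt hz hy (κ := b + ε) (by linarith)
  obtain ⟨u₂, η₂, hu₂0, hu₂1, hη₂, ht₂⟩ := exists_contactTilt_lt hz hy (κ := b - ε) (by linarith)
  obtain ⟨C₁, θ₁, hC₁, hθ₁, hθ₁1, h₁⟩ := fraction_le_geometric_of_tilt_top hy hz (zero_lt_one.trans hu₁) hη₁ ht₁ _
    (fun N => sum_topContacts_ge_mul_rpow_le hy.le hz.le hu₁.le N (b + ε))
  obtain ⟨C₂, θ₂, hC₂, hθ₂, hθ₂1, h₂⟩ := fraction_le_geometric_of_tilt_top hy hz hu₂0 hη₂ ht₂ _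
    (fun N => sum_topContacts_le_mul_rpow_le hy.le hz.le hu₂0 hu₂1.le N (b - ε))
  have hlim : Tendsto (fun N : ℕ => C₁ * θ₁ ^ N + C₂ * θ₂ ^ N) atTop (𝓝 0) := by
    have := ((tendsto_pow_atTop_nhds_zero_of_lt_one hθ₁ hθ₁1).const_mul C₁).add
      ((tendsto_pow_atTop_nhds_zero_of_lt_one hθ₂ hθ₂1).const_mul C₂)
    simpa using this
  have hZ : ∀ N, 0 < stripZ₂ 1 N y z := fun N => stripZ₂_pos 1 N hy hz
  refine squeeze_zero' (Eventually.of_forall fun N => div_nonneg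
    (Finset.sum_nonneg fun q _ => wgt_nonneg hy.le hz.le N q) (hZ N).le) ?_ hlim
  filter_upwards [h₁, h₂, eventually_ge_atTop 1] with N hA hB hN
  have hN' : (0 : ℝ) < N := by exact_mod_cast hN
  have hsub : ((stripPairs 1 N).filter fun q => ε ≤ |(topVisits₀ 1 q.1 q.2 N : ℝ) / N - b|) ⊆
      ((stripPairs 1 N).filter fun q => (b + ε) * N ≤ (topVisits₀ 1 q.1 q.2 N : ℝ)) ∪
      ((stripPairs 1 N).filter fun q => (topVisits₀ 1 q.1 q.2 N : ℝ) ≤ (b - ε) * N) := by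
    intro q hq
    rw [Finset.mem_filter] at hq
    obtain ⟨hq, hdev⟩ := hq
    rw [Finset.mem_union, Finset.mem_filter, Finset.mem_filter]
    rcases le_abs'.1 hdev with h | h
    · right; refine ⟨hq, ?_⟩
      have h' : (topVisits₀ 1 q.1 q.2 N : ℝ) / N ≤ b - ε := by linarith
      rwa [div_le_iff₀ hN'] at h'
    · left; refine ⟨hq, ?_⟩
      have h' : b + ε ≤ (topVisits₀ 1 q.1 q.2 N : ℝ) / N := by linarith
      rwa [le_div_iff₀ hN'] at h'
  calc (∑ q ∈ (stripPairs 1 N).filter (fun q => ε ≤ |(topVisits₀ 1 q.1 q.2 N : ℝ) / N - b|), wgt y z N q) / stripZ₂ 1 N y z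
      ≤ ((∑ q ∈ (stripPairs 1 N).filter (fun q => (b + ε) * N ≤ (topVisits₀ 1 q.1 q.2 N : ℝ)), wgt y z N q) +
          (∑ q ∈ (stripPairs 1 N).filter (fun q => (topVisits₀ 1 q.1 q.2 N : ℝ) ≤ (b - ε) * N), wgt y z N q)) /
          stripZ₂ 1 N y z := by
        gcongr
        · exact (hZ N).le
        calc ∑ q ∈ (stripPairs 1 N).filter (fun q => ε ≤ |(topVisits₀ 1 q.1 q.2 N : ℝ) / N - b|), wgt y z N q
            ≤ ∑ q ∈ ((stripPairs 1 N).filter fun q => (b + ε) * N ≤ (topVisits₀ 1 q.1 q.2 N : ℝ)) ∪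
                ((stripPairs 1 N).filter fun q => (topVisits₀ 1 q.1 q.2 N : ℝ) ≤ (b - ε) * N), wgt y z N q :=
              Finset.sum_le_sum_of_subset_of_nonneg hsub fun q _ _ => wgt_nonneg hy.le hz.le N q
          _ ≤ _ := by
              rw [← Finset.sum_union_inter]
              linarith [Finset.sum_nonneg (s := ((stripPairs 1 N).filter fun q => (b + ε) * N ≤ (topVisits₀ 1 q.1 q.2 N : ℝ)) ∩
                ((stripPairs 1 N).filter fun q => (topVisits₀ 1 q.1 q.2 N : ℝ) ≤ (b - ε) * N))
                (fun q _ => wgt_nonneg hy.le hz.le N q)]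
    _ = _ := add_div _ _ _
    _ ≤ C₁ * θ₁ ^ N + C₂ * θ₂ ^ N := add_le_add hA hB

/-! ## §7 Consistency with the unweighted walk: `b(1,1) = v/4` -/

/-- ★ **`b(1,1) = μ²/(2(3μ² − 1)) = (μ+1)/(2(2μ+3)) = stripOneSpeed/4`** (`μ³ = μ + 1`): a quarter of the steps of a
long uniform SAW in `S_1` land on bottom surface sites of the printed kind, a quarter on top ones, and `v/2 = 1 − v/2 − …`
— precisely, bottom + top contact densities sum to half the speed. [cite: MadrasSlade1993, §1.1 eq. (1.1.5); BeatonBousquetMelouDeGierDuminilCopinGuttmann2014, §3.2 Proposition 6 (arXiv v5 p. 10)] -/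
theorem contactB_one_one : contactB 1 1 = stripOneSpeed / 4 := by
  have hμeq : stripMuY₂ 1 1 1 = stripConnectiveConstant 1 := stripMuY₂_one_one_one 1
  set μ := stripConnectiveConstant 1 with hμ
  have hμ1 : 1 < μ := by have := stripConnectiveConstant_one_mem_Ioo.1; rw [← hμ] at this; linarith
  have hc : μ ^ 3 = μ + 1 := by rw [hμ]; exact stripConnectiveConstant_one_pow_three
  have hs1 : 0 < μ ^ 2 - 1 := by nlinarith
  have hb : contactB 1 1 = μ ^ 2 / (2 * (3 * μ ^ 2 - 1)) := by
    unfold contactB sexticDeriv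
    rw [hμeq, div_eq_div_iff (by positivity) (by nlinarith)]
    ring
  have hv : stripOneSpeed / 4 = (μ + 1) / (2 * (2 * μ + 3)) := by
    rw [stripOneSpeed_eq, ← hμ]
    have : (2 : ℝ) * μ + 3 ≠ 0 := by linarith
    field_simp
    ring
  rw [hb, hv, div_eq_div_iff (by nlinarith) (by linarith)]
  linear_combination (-2 : ℝ) * hc

/-! ## §8 Half the speed is the total contact density: `b(y,z) + b(z,y) = v(y,z)/2` -/

/-- ★★ **`b(y,z) + b(z,y) = v(y,z)/2`** for every `y, z > 0`, with the two-wall speed `v(y,z) = HexBW.twoWallSpeed y z` of the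
previous file: in the long run half of the steps of the adsorbing strip walk land on surface sites of the printed kind
(bottom odd / top even abscissa), split between the two walls as `b(y,z) : b(z,y) = (s − z) : (s − y)`.  Pure algebra on
`M(y,z) = 3 + y/(s−y) + z/(s−z)`: `1 − 1/M = s(2s − y − z)/F(s)`. [cite: BeatonBousquetMelouDeGierDuminilCopinGuttmann2014, §3.2 Proposition 6 (arXiv v5 p. 10); MadrasSlade1993, §1.1 eq. (1.1.5)] -/
theorem contactB_add_contactB_swap (hy : 0 < y) (hz : 0 < z) : contactB y z + contactB z y = twoWallSpeed y z / 2 := by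
  obtain ⟨hys, hzs, hF, -, -, -⟩ := contactB_facts hy hz
  have hμ := stripMuY₂_pos 1 hy hz
  rw [contactB_swap y z, twoWallSpeed, twoWallRho, twoWallM]
  unfold contactB
  set μ := stripMuY₂ 1 y z with hμdef
  have hs0 : 0 < μ ^ 2 := by positivity
  have e1 : y * μ⁻¹ ^ 2 / (1 - y * μ⁻¹ ^ 2) = y / (μ ^ 2 - y) := by
    have : μ ^ 2 - y ≠ 0 := by linarith
    have : 1 - y * μ⁻¹ ^ 2 = (μ ^ 2 - y) / μ ^ 2 := by field_simp
    rw [this]; field_simp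
  have e2 : z * μ⁻¹ ^ 2 / (1 - z * μ⁻¹ ^ 2) = z / (μ ^ 2 - z) := by
    have : μ ^ 2 - z ≠ 0 := by linarith
    have : 1 - z * μ⁻¹ ^ 2 = (μ ^ 2 - z) / μ ^ 2 := by field_simp
    rw [this]; field_simp
  rw [e1, e2]
  have h1 : μ ^ 2 - y ≠ 0 := by linarith
  have h2 : μ ^ 2 - z ≠ 0 := by linarith
  have hF' : sexticDeriv y z (μ ^ 2) ≠ 0 := hF.ne'
  have hM : 3 + y / (μ ^ 2 - y) + z / (μ ^ 2 - z) = sexticDeriv y z (μ ^ 2) / ((μ ^ 2 - y) * (μ ^ 2 - z)) := by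
    unfold sexticDeriv; field_simp; ring
  rw [hM, one_div_div]
  field_simp
  unfold sexticDeriv
  ring

/-! ## §9 (ed.2) The free energy is differentiable in `log y` and its derivative IS the contact density -/

/-- The negative-side twin of `tiltG_eventually_pos`: if `G(1) = 0` and `G'(1) < 0` then `G(u) < 0` just above `1`; if
`G'(1) > 0` then `G(u) < 0` just below `1`. [cite: MadrasSlade1993, §1.2 (elementary calculus)] -/
theorem tiltG_eventually_neg (y z s c : ℝ) (h0 : tiltG y z s c 1 = 0) :
    (2 * c * s * sexticDeriv y z s - y * (s * (s - z) + z) < 0 → ∀ᶠ u in 𝓝[>] 1, tiltG y z s c u < 0) ∧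
    (0 < 2 * c * s * sexticDeriv y z s - y * (s * (s - z) + z) → ∀ᶠ u in 𝓝[<] 1, tiltG y z s c u < 0) := by
  have hD := hasDerivAt_tiltG y z s c
  constructor
  · intro hneg
    have hslope := (hasDerivAt_iff_tendsto_slope.1 hD).eventually (gt_mem_nhds hneg)
    have hev1 : ∀ᶠ u in 𝓝[>] (1 : ℝ), slope (tiltG y z s c) 1 u < 0 :=
      hslope.filter_mono (nhdsWithin_mono _ fun u hu => ne_of_gt hu)
    have hev2 : ∀ᶠ u in 𝓝[>] (1 : ℝ), 1 < u := eventually_mem_nhdsWithin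
    filter_upwards [hev1, hev2] with u h1 h2
    rw [slope_def_field, h0, sub_zero] at h1
    rcases div_neg_iff.1 h1 with ⟨hp, hn⟩ | ⟨hneg', -⟩
    · linarith
    · exact hneg'
  · intro hpos
    have hslope := (hasDerivAt_iff_tendsto_slope.1 hD).eventually (lt_mem_nhds hpos)
    have hev1 : ∀ᶠ u in 𝓝[<] (1 : ℝ), 0 < slope (tiltG y z s c) 1 u :=
      hslope.filter_mono (nhdsWithin_mono _ fun u hu => ne_of_lt hu)
    have hev2 : ∀ᶠ u in 𝓝[<] (1 : ℝ), u < 1 := eventually_mem_nhdsWithin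
    filter_upwards [hev1, hev2] with u h1 h2
    rw [slope_def_field, h0, sub_zero] at h1
    rcases div_pos_iff.1 h1 with ⟨hp, hn⟩ | ⟨hneg', -⟩
    · linarith
    · exact hneg'

/-- **The two criteria near `u = 1`**: for `u` close to `1`, `G(u) ≥ 0 ⇒ μ_1(yu,z) ≤ μ_1(y,z) u^c` and
`G(u) ≤ 0 ⇒ μ_1(y,z) u^c ≤ μ_1(yu,z)` (`s = μ_1(y,z)²`; tree criteria `stripMuY₂_one_le_iff`, `le_stripMuY₂_one_iff`).
[cite: BeatonBousquetMelouDeGierDuminilCopinGuttmann2014, §3.2 Proposition 6 (arXiv v5 p. 10)] -/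
theorem eventually_tilt_criteria (hy : 0 < y) (hz : 0 < z) (c : ℝ) :
    ∀ᶠ u in 𝓝 (1 : ℝ), (0 ≤ tiltG y z (stripMuY₂ 1 y z ^ 2) c u → stripMuY₂ 1 (y * u) z ≤ stripMuY₂ 1 y z * u ^ c) ∧
      (tiltG y z (stripMuY₂ 1 y z ^ 2) c u ≤ 0 → stripMuY₂ 1 y z * u ^ c ≤ stripMuY₂ 1 (y * u) z) := by
  obtain ⟨hys, hzs, -, -, -, -⟩ := contactB_facts hy hz
  set μ := stripMuY₂ 1 y z with hμ
  have hμ0 : 0 < μ := stripMuY₂_pos 1 hy hz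
  set s := μ ^ 2 with hs
  have hcont : ContinuousAt (fun u : ℝ => s * u ^ (2 * c) - max (y * u) z) 1 :=
    (continuousAt_const.mul (Real.continuousAt_rpow_const _ _ (Or.inl one_ne_zero))).sub
      ((continuousAt_const.mul continuousAt_id).max continuousAt_const)
  have hat1 : 0 < s * (1 : ℝ) ^ (2 * c) - max (y * 1) z := by
    rw [Real.one_rpow, mul_one, mul_one]; exact sub_pos.2 (max_lt hys hzs)
  filter_upwards [hcont.eventually (lt_mem_nhds hat1), lt_mem_nhds (zero_lt_one : (0 : ℝ) < 1)] with u hm hu0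
  have hρ0 : 0 < μ * u ^ c := mul_pos hμ0 (Real.rpow_pos_of_pos hu0 c)
  have hρ2 : (μ * u ^ c) ^ 2 = s * u ^ (2 * c) := by
    rw [mul_pow, hs, ← Real.rpow_natCast (u ^ c) 2, ← Real.rpow_mul hu0.le]; push_cast; ring_nf
  have hmax : max (y * u) z ≤ (μ * u ^ c) ^ 2 := by rw [hρ2]; linarith
  constructor
  · intro hG
    rw [stripMuY₂_one_le_iff (mul_pos hy hu0) hz hρ0 hmax, hρ2]
    unfold tiltG at hG; linarith
  · intro hG
    rw [le_stripMuY₂_one_iff (mul_pos hy hu0) hz hρ0 hmax, hρ2]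
    unfold tiltG at hG; linarith

/-- ★★ **Local two-sided comparison of the growth rates**: for `c₁ < b(y,z) < c₂` and `u ≠ 1` close to `1`,
`c₁ · slope(log)(1,u) ≤ slope(u ↦ log μ_1(yu,z))(1,u) ≤ c₂ · slope(log)(1,u)`.
[cite: BeatonBousquetMelouDeGierDuminilCopinGuttmann2014, §3.2 Proposition 6 (arXiv v5 p. 10); MadrasSlade1993, §1.2] -/
theorem eventually_slope_log_stripMuY₂_sandwich (hy : 0 < y) (hz : 0 < z) {c₁ c₂ : ℝ} (h₁ : c₁ < contactB y z)
    (h₂ : contactB y z < c₂) :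
    ∀ᶠ u in 𝓝[≠] (1 : ℝ), c₁ * slope Real.log 1 u ≤ slope (fun u => Real.log (stripMuY₂ 1 (y * u) z)) 1 u ∧
      slope (fun u => Real.log (stripMuY₂ 1 (y * u) z)) 1 u ≤ c₂ * slope Real.log 1 u := by
  obtain ⟨hys, hzs, hF, hsex, hb0, -⟩ := contactB_facts hy hz
  set μ := stripMuY₂ 1 y z with hμ
  have hμ0 : 0 < μ := stripMuY₂_pos 1 hy hz
  set s := μ ^ 2 with hs
  have hs0 : 0 < s := by positivity
  -- signs of `G'(1)` for `c₁` and `c₂`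
  have e : y * (s * (s - z) + z) = s * (s * (s - z)) := by linear_combination (-1 : ℝ) * hsex
  have hder₁ : 2 * c₁ * s * sexticDeriv y z s - y * (s * (s - z) + z) < 0 := by
    rw [e]
    have : 2 * c₁ * sexticDeriv y z s < s * (s - z) := by
      have h := h₁; unfold contactB at h; rw [← hμ, ← hs, lt_div_iff₀ (by positivity)] at h; linarith
    nlinarith
  have hder₂ : 0 < 2 * c₂ * s * sexticDeriv y z s - y * (s * (s - z) + z) := by
    rw [e]
    have : s * (s - z) < 2 * c₂ * sexticDeriv y z s := by
      have h := h₂; unfold contactB at h; rw [← hμ, ← hs, div_lt_iff₀ (by positivity)] at h; linarith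
    nlinarith
  have h0₁ : tiltG y z s c₁ 1 = 0 := by rw [tiltG_one]; linarith
  have h0₂ : tiltG y z s c₂ 1 = 0 := by rw [tiltG_one]; linarith
  have hcrit₁ := eventually_tilt_criteria hy hz c₁
  have hcrit₂ := eventually_tilt_criteria hy hz c₂
  rw [← hμ, ← hs] at hcrit₁ hcrit₂
  -- the slope of `f(u) = log μ_1(yu,z)` against the slope of `log`
  have key : ∀ u : ℝ, 0 < u → u ≠ 1 →
      (stripMuY₂ 1 (y * u) z ≤ μ * u ^ c₂ → μ * u ^ c₁ ≤ stripMuY₂ 1 (y * u) z → 1 < u →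
        c₁ * slope Real.log 1 u ≤ slope (fun u => Real.log (stripMuY₂ 1 (y * u) z)) 1 u ∧
        slope (fun u => Real.log (stripMuY₂ 1 (y * u) z)) 1 u ≤ c₂ * slope Real.log 1 u) ∧
      (stripMuY₂ 1 (y * u) z ≤ μ * u ^ c₁ → μ * u ^ c₂ ≤ stripMuY₂ 1 (y * u) z → u < 1 →
        c₁ * slope Real.log 1 u ≤ slope (fun u => Real.log (stripMuY₂ 1 (y * u) z)) 1 u ∧
        slope (fun u => Real.log (stripMuY₂ 1 (y * u) z)) 1 u ≤ c₂ * slope Real.log 1 u) := by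
    intro u hu0 hu1
    have hμu : 0 < stripMuY₂ 1 (y * u) z := stripMuY₂_pos 1 (mul_pos hy hu0) hz
    have hlogpow : ∀ c : ℝ, Real.log (μ * u ^ c) = Real.log μ + c * Real.log u := fun c => by
      rw [Real.log_mul hμ0.ne' (Real.rpow_pos_of_pos hu0 c).ne', Real.log_rpow hu0]
    have hf1 : (fun u => Real.log (stripMuY₂ 1 (y * u) z)) 1 = Real.log μ := by simp [hμ]
    simp only [slope_def_field, hf1, Real.log_one, sub_zero]
    constructor
    · intro hup hlow hgt
      have hd : 0 < u - 1 := by linarith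
      have hA : Real.log (stripMuY₂ 1 (y * u) z) - Real.log μ ≤ c₂ * Real.log u := by
        have := Real.log_le_log hμu hup; rw [hlogpow] at this; linarith
      have hB : c₁ * Real.log u ≤ Real.log (stripMuY₂ 1 (y * u) z) - Real.log μ := by
        have := Real.log_le_log (mul_pos hμ0 (Real.rpow_pos_of_pos hu0 _)) hlow; rw [hlogpow] at this; linarith
      constructor
      · rw [mul_div_assoc']; exact div_le_div_of_nonneg_right hB hd.le
      · rw [mul_div_assoc']; exact div_le_div_of_nonneg_right hA hd.le
    · intro hup hlow hlt
      have hd : u - 1 < 0 := by linarith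
      have hA : Real.log (stripMuY₂ 1 (y * u) z) - Real.log μ ≤ c₁ * Real.log u := by
        have := Real.log_le_log hμu hup; rw [hlogpow] at this; linarith
      have hB : c₂ * Real.log u ≤ Real.log (stripMuY₂ 1 (y * u) z) - Real.log μ := by
        have := Real.log_le_log (mul_pos hμ0 (Real.rpow_pos_of_pos hu0 _)) hlow; rw [hlogpow] at this; linarith
      constructor
      · rw [mul_div_assoc']; exact div_le_div_of_nonpos_of_le hd.le hA
      · rw [mul_div_assoc']; exact div_le_div_of_nonpos_of_le hd.le hB
  -- assemble on `𝓝[>] 1` and `𝓝[<] 1`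
  rw [← nhdsLT_sup_nhdsGT, Filter.eventually_sup]
  constructor
  · have hG₁ := (tiltG_eventually_pos y z s c₁ h0₁).2 hder₁   -- G_{c₁} > 0 below 1 ⇒ μ(yu) ≤ μ u^{c₁}
    have hG₂ := (tiltG_eventually_neg y z s c₂ h0₂).2 hder₂   -- G_{c₂} < 0 below 1 ⇒ μ u^{c₂} ≤ μ(yu)
    have hlt : ∀ᶠ u in 𝓝[<] (1 : ℝ), u < 1 := eventually_mem_nhdsWithin
    have hpos : ∀ᶠ u in 𝓝[<] (1 : ℝ), 0 < u := (lt_mem_nhds zero_lt_one).filter_mono nhdsWithin_le_nhds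
    filter_upwards [hG₁, hG₂, hlt, hpos, hcrit₁.filter_mono nhdsWithin_le_nhds, hcrit₂.filter_mono nhdsWithin_le_nhds]
      with u hG1 hG2 hu1 hu0 hc1 hc2
    exact (key u hu0 (ne_of_lt hu1)).2 (hc1.1 hG1.le) (hc2.2 hG2.le) hu1
  · have hG₂ := (tiltG_eventually_pos y z s c₂ h0₂).1 hder₂   -- G_{c₂} > 0 above 1 ⇒ μ(yu) ≤ μ u^{c₂}
    have hG₁ := (tiltG_eventually_neg y z s c₁ h0₁).1 hder₁   -- G_{c₁} < 0 above 1 ⇒ μ u^{c₁} ≤ μ(yu)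
    have hgt : ∀ᶠ u in 𝓝[>] (1 : ℝ), 1 < u := eventually_mem_nhdsWithin
    filter_upwards [hG₁, hG₂, hgt, hcrit₁.filter_mono nhdsWithin_le_nhds, hcrit₂.filter_mono nhdsWithin_le_nhds]
      with u hG1 hG2 hu1 hc1 hc2
    exact (key u (zero_lt_one.trans hu1) (ne_of_gt hu1)).1 (hc2.1 hG2.le) (hc1.2 hG1.le) hu1

/-- ★★★ **THE FREE ENERGY IS DIFFERENTIABLE IN `log y` AND ITS DERIVATIVE IS THE CONTACT DENSITY**:
`d/du log μ_1(yu, z) |_{u=1} = b(y,z)` for every `y, z > 0` — the thermodynamic identification of the adsorbed fraction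
with the fugacity-derivative of the growth rate, here an honest `HasDerivAt`.
[cite: BeatonBousquetMelouDeGierDuminilCopinGuttmann2014, §3.2 Proposition 6 (arXiv v5 p. 10); MadrasSlade1993, §8.5 pp. 278–279] -/
theorem hasDerivAt_log_stripMuY₂_tilt (hy : 0 < y) (hz : 0 < z) :
    HasDerivAt (fun u => Real.log (stripMuY₂ 1 (y * u) z)) (contactB y z) 1 := by
  set b := contactB y z with hb
  have hlog : Tendsto (slope Real.log 1) (𝓝[≠] (1 : ℝ)) (𝓝 1) := by
    have h := Real.hasDerivAt_log (one_ne_zero : (1 : ℝ) ≠ 0)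
    rw [inv_one] at h
    exact hasDerivAt_iff_tendsto_slope.1 h
  rw [hasDerivAt_iff_tendsto_slope, tendsto_order]
  constructor
  · intro a ha
    set c₁ := (a + b) / 2 with hc₁
    have hc₁a : a < c₁ := by rw [hc₁]; linarith
    have hc₁b : c₁ < b := by rw [hc₁]; linarith
    have hsand := eventually_slope_log_stripMuY₂_sandwich hy hz hc₁b (by linarith : b < b + 1)
    have hlim : ∀ᶠ u in 𝓝[≠] (1 : ℝ), a < c₁ * slope Real.log 1 u :=
      (hlog.const_mul c₁).eventually (lt_mem_nhds (by rw [mul_one]; exact hc₁a))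
    filter_upwards [hsand, hlim] with u hs hl
    exact hl.trans_le hs.1
  · intro a ha
    set c₂ := (a + b) / 2 with hc₂
    have hc₂a : c₂ < a := by rw [hc₂]; linarith
    have hc₂b : b < c₂ := by rw [hc₂]; linarith
    obtain ⟨-, -, -, -, hb0, -⟩ := contactB_facts hy hz
    have hsand := eventually_slope_log_stripMuY₂_sandwich hy hz (by linarith : b / 2 < b) hc₂b
    have hlim : ∀ᶠ u in 𝓝[≠] (1 : ℝ), c₂ * slope Real.log 1 u < a :=
      (hlog.const_mul c₂).eventually (gt_mem_nhds (by rw [mul_one]; exact hc₂a))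
    filter_upwards [hsand, hlim] with u hs hl
    exact hs.2.trans_lt hl

/-- ★★★ **`∂_y log μ_1(y,z) = b(y,z)/y`** (the same in the variable `y` itself).
[cite: BeatonBousquetMelouDeGierDuminilCopinGuttmann2014, §3.2 Proposition 6 (arXiv v5 p. 10); MadrasSlade1993, §8.5 pp. 278–279] -/
theorem hasDerivAt_log_stripMuY₂_one (hy : 0 < y) (hz : 0 < z) :
    HasDerivAt (fun y' => Real.log (stripMuY₂ 1 y' z)) (contactB y z / y) y := by
  have h := hasDerivAt_log_stripMuY₂_tilt hy hz
  -- compose with `u = y'/y`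
  have hlin : HasDerivAt (fun y' : ℝ => y' / y) (1 / y) y := by
    simpa using (hasDerivAt_id y).div_const y
  have hcomp := HasDerivAt.comp y (h₂ := fun u => Real.log (stripMuY₂ 1 (y * u) z)) (by rw [div_self hy.ne']; exact h) hlin
  have e : (fun u => Real.log (stripMuY₂ 1 (y * u) z)) ∘ (fun y' : ℝ => y' / y) = fun y' => Real.log (stripMuY₂ 1 y' z) := by
    funext y'; simp only [Function.comp]; rw [mul_div_cancel₀ _ hy.ne']
  rw [e] at hcomp
  exact hcomp.congr_deriv (by ring)

/-! ## §10 (ed.2) Convexity of the free energy in `log y` (tree: `convexOn_log_stripMuY₂_exp`) ⇒ the contact density is monotone -/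

/-- **One-variable section of the tree's joint log-convexity** (`HexBW.convexOn_log_stripMuY₂_exp`, Hölder): `t ↦ log μ_1(e^t, z)`
is convex on `ℝ`. [cite: BeatonBousquetMelouDeGierDuminilCopinGuttmann2014, §3.2 Proposition 6 (arXiv v5 p. 10); MadrasSlade1993, §1.2] -/
theorem convexOn_log_stripMuY₂_one_exp_left (hz : 0 < z) :
    ConvexOn ℝ Set.univ (fun t => Real.log (stripMuY₂ 1 (Real.exp t) z)) := by
  refine ⟨convex_univ, fun a _ b _ lam mu hlam hmu hsum => ?_⟩
  have h := (convexOn_log_stripMuY₂_exp 1).2 (Set.mem_univ (a, Real.log z)) (Set.mem_univ (b, Real.log z)) hlam hmu hsum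
  simp only [Prod.smul_mk, Prod.mk_add_mk, smul_eq_mul, Real.exp_log hz] at h ⊢
  have e : lam * Real.log z + mu * Real.log z = Real.log z := by rw [← add_mul, hsum, one_mul]
  rwa [e, Real.exp_log hz] at h

/-- The derivative of `t ↦ log μ_1(e^t, z)` is `b(e^t, z)`. [cite: BeatonBousquetMelouDeGierDuminilCopinGuttmann2014, §3.2 Proposition 6 (arXiv v5 p. 10)] -/
theorem hasDerivAt_log_stripMuY₂_exp (hz : 0 < z) (t : ℝ) :
    HasDerivAt (fun t => Real.log (stripMuY₂ 1 (Real.exp t) z)) (contactB (Real.exp t) z) t := by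
  have hy := Real.exp_pos t
  have h := hasDerivAt_log_stripMuY₂_one hy hz
  have hcomp := HasDerivAt.comp t (h₂ := fun y' => Real.log (stripMuY₂ 1 y' z)) h (Real.hasDerivAt_exp t)
  exact hcomp.congr_deriv (by field_simp)

/-- ★★★ **THE CONTACT DENSITY IS NON-DECREASING IN THE FUGACITY**: `y ≤ y' ⇒ b(y,z) ≤ b(y',z)` (`y, z > 0`) — more
attraction, more contacts (convexity of the free energy). [cite: BeatonBousquetMelouDeGierDuminilCopinGuttmann2014, §3.2 Proposition 6 (arXiv v5 p. 10); MadrasSlade1993, §1.2] -/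
theorem contactB_mono_left (hy : 0 < y) (hz : 0 < z) {y' : ℝ} (hyy : y ≤ y') : contactB y z ≤ contactB y' z := by
  have hy' : 0 < y' := hy.trans_le hyy
  have hmono := (convexOn_log_stripMuY₂_one_exp_left hz).monotoneOn_deriv
    (fun t _ => (hasDerivAt_log_stripMuY₂_exp hz t).differentiableAt)
  have h := hmono (Set.mem_univ (Real.log y)) (Set.mem_univ (Real.log y')) (Real.log_le_log hy hyy)
  rwa [(hasDerivAt_log_stripMuY₂_exp hz (Real.log y)).deriv, (hasDerivAt_log_stripMuY₂_exp hz (Real.log y')).deriv,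
    Real.exp_log hy, Real.exp_log hy'] at h

/-- ★★ **…and the top contact density is non-decreasing in ITS fugacity**: `z ≤ z' ⇒ b(z,y) ≤ b(z',y)`.
[cite: BeatonBousquetMelouDeGierDuminilCopinGuttmann2014, Proposition 6 (arXiv v5 p. 10: μ_T(y,z) symmetric)] -/
theorem contactB_swap_mono (hy : 0 < y) (hz : 0 < z) {z' : ℝ} (hzz : z ≤ z') : contactB z y ≤ contactB z' y :=
  contactB_mono_left hz hy hzz

/-! ## §11 (ed.3) The phase portrait in `y`: desorption `b → 0` as `y → 0⁺`, saturation `b → 1/2` as `y → ∞` -/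

/-- Quantitative bounds on `s = μ_1(y,z)²` from the sextic law: `s − y ≤ z/(y − z)` when `y > z`, and `s − z ≤ 2y/z` when
`2y ≤ z`. [cite: BeatonBousquetMelouDeGierDuminilCopinGuttmann2014, §3.2 Proposition 6 (arXiv v5 p. 10)] -/
theorem stripMuY₂_one_sq_sub_le (hy : 0 < y) (hz : 0 < z) :
    (z < y → stripMuY₂ 1 y z ^ 2 - y ≤ z / (y - z)) ∧ (2 * y ≤ z → stripMuY₂ 1 y z ^ 2 - z ≤ 2 * y / z) := by
  obtain ⟨hys, hzs, -, hsex, -, -⟩ := contactB_facts hy hz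
  set s := stripMuY₂ 1 y z ^ 2 with hs
  constructor
  · intro hzy
    have hyz : 0 < y - z := by linarith
    rw [le_div_iff₀ hyz]
    -- `(s − y) · s(s − z) = yz` and `s(s−z) ≥ y(y−z)`
    have h1 : (s - y) * (s * (s - z)) = y * z := by linear_combination hsex
    have h2 : y * (y - z) ≤ s * (s - z) := by nlinarith
    nlinarith [mul_le_mul_of_nonneg_left h2 (sub_pos.2 hys).le]
  · intro h2y
    have hzy : 0 < z - y := by linarith
    rw [le_div_iff₀ hz]
    have h1 : (s - z) * (s * (s - y)) = y * z := by linear_combination hsex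
    have h2 : z * (z / 2) ≤ s * (s - y) := by nlinarith
    nlinarith [mul_le_mul_of_nonneg_left h2 (sub_pos.2 hzs).le]

/-- ★★ **Saturation bound**: `|b(y,z) − 1/2| ≤ z/(y − z)²` for `y > z`. [cite: BeatonBousquetMelouDeGierDuminilCopinGuttmann2014, §3.2 Proposition 6 (arXiv v5 p. 10); MadrasSlade1993, §1.2] -/
theorem abs_contactB_sub_half_le (hy : 0 < y) (hz : 0 < z) (hzy : z < y) :
    |contactB y z - 1 / 2| ≤ z / (y - z) ^ 2 := by
  obtain ⟨hys, hzs, hF, hsex, hb0, hb1⟩ := contactB_facts hy hz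
  have hsy := (stripMuY₂_one_sq_sub_le hy hz).1 hzy
  set s := stripMuY₂ 1 y z ^ 2 with hs
  have hyz : 0 < y - z := by linarith
  have hs0 : 0 < s := hy.trans hys
  have hFne : sexticDeriv y z s ≠ 0 := hF.ne'
  have hb : contactB y z = s * (s - z) / (2 * sexticDeriv y z s) := rfl
  rw [abs_sub_comm, abs_of_nonneg (by linarith)]
  have h2F : 2 * sexticDeriv y z s ≠ 0 := by positivity
  have key : 1 / 2 - contactB y z = (s - y) * (2 * s - z) / (2 * sexticDeriv y z s) := by
    rw [hb, eq_div_iff h2F, sub_mul, div_mul_cancel₀ _ h2F]; unfold sexticDeriv; ring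
  rw [key]
  have hA : (s - y) * (2 * s - z) / (2 * sexticDeriv y z s) ≤ (s - y) / (s - z) := by
    rw [div_le_div_iff₀ (by positivity) (sub_pos.2 hzs)]
    unfold sexticDeriv
    have h1 : 0 ≤ s - y := (sub_pos.2 hys).le
    have h2 : (2 * s - z) * (s - z) ≤ 2 * ((s - y) * (s - z) + s * (s - z) + s * (s - y)) := by
      nlinarith [mul_pos (sub_pos.2 hys) (sub_pos.2 hzs), mul_pos hs0 (sub_pos.2 hys), mul_pos hs0 (sub_pos.2 hzs)]
    nlinarith [mul_le_mul_of_nonneg_left h2 h1]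
  have hB : (s - y) / (s - z) ≤ z / (y - z) ^ 2 := by
    rw [div_le_div_iff₀ (sub_pos.2 hzs) (by positivity)]
    have h1 : (s - y) * (y - z) ≤ z := by rwa [le_div_iff₀ hyz] at hsy
    have h2 : y - z ≤ s - z := by linarith
    nlinarith [mul_le_mul_of_nonneg_right h1 hyz.le, mul_le_mul_of_nonneg_left h2 hz.le]
  exact hA.trans hB

/-- ★★ **Desorption bound**: `b(y,z) ≤ 2y/z²` for `0 < 2y ≤ z`. [cite: BeatonBousquetMelouDeGierDuminilCopinGuttmann2014, §3.2 Proposition 6 (arXiv v5 p. 10); MadrasSlade1993, §1.2] -/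
theorem contactB_le_of_small (hy : 0 < y) (hz : 0 < z) (h2y : 2 * y ≤ z) : contactB y z ≤ 2 * y / z ^ 2 := by
  obtain ⟨hys, hzs, hF, hsex, hb0, hb1⟩ := contactB_facts hy hz
  have hsz := (stripMuY₂_one_sq_sub_le hy hz).2 h2y
  set s := stripMuY₂ 1 y z ^ 2 with hs
  have hb : contactB y z = s * (s - z) / (2 * sexticDeriv y z s) := rfl
  have hs0 : 0 < s := hy.trans hys
  have hsy2 : z / 2 ≤ s - y := by linarith
  have hA : contactB y z ≤ s * (s - z) / (2 * (s * (s - y))) := by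
    rw [hb]
    apply div_le_div_of_nonneg_left (mul_nonneg hs0.le (sub_pos.2 hzs).le) (by positivity)
    unfold sexticDeriv
    nlinarith [mul_pos (sub_pos.2 hys) (sub_pos.2 hzs), mul_pos hs0 (sub_pos.2 hzs)]
  have hB : s * (s - z) / (2 * (s * (s - y))) = (s - z) / (2 * (s - y)) := by
    field_simp
  have hC : (s - z) / (2 * (s - y)) ≤ 2 * y / z ^ 2 := by
    rw [div_le_div_iff₀ (by linarith) (by positivity)]
    have h1 : (s - z) * z ≤ 2 * y := by rwa [le_div_iff₀ hz] at hsz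
    have h2 : z ≤ 2 * (s - y) := by linarith
    nlinarith [mul_le_mul_of_nonneg_right h1 hz.le, mul_le_mul_of_nonneg_left h2 (by linarith : (0:ℝ) ≤ 2 * y)]
  calc contactB y z ≤ s * (s - z) / (2 * (s * (s - y))) := hA
    _ = (s - z) / (2 * (s - y)) := hB
    _ ≤ 2 * y / z ^ 2 := hC

/-- ★★★ **SATURATION**: `b(y,z) → 1/2` as `y → ∞` (`z > 0` fixed): in the limit of strong bottom attraction, half of the
steps — every other site of the bottom row — are contacts. [cite: BeatonBousquetMelouDeGierDuminilCopinGuttmann2014, §3.2 Proposition 6 (arXiv v5 p. 10); MadrasSlade1993, §8.5 pp. 278–279] -/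
theorem tendsto_contactB_atTop (hz : 0 < z) : Tendsto (fun y => contactB y z) atTop (𝓝 (1 / 2)) := by
  have h1 : Tendsto (fun y : ℝ => y - z) atTop atTop := tendsto_atTop_add_const_right _ (-z) tendsto_id
  have h2 : Tendsto (fun y : ℝ => (y - z) ^ 2) atTop atTop := Filter.tendsto_pow_atTop two_ne_zero |>.comp h1
  have hlim : Tendsto (fun y : ℝ => z / (y - z) ^ 2) atTop (𝓝 0) := tendsto_const_nhds.div_atTop h2
  rw [Metric.tendsto_atTop] at hlim ⊢
  intro ε hε
  obtain ⟨N, hN⟩ := hlim ε hε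
  refine ⟨max N (z + 1), fun y hy => ?_⟩
  have hyN : N ≤ y := le_trans (le_max_left _ _) hy
  have hzy : z < y := by linarith [le_max_right N (z + 1)]
  have hy0 : 0 < y := hz.trans hzy
  have hb := abs_contactB_sub_half_le hy0 hz hzy
  have hNy := hN y hyN
  rw [Real.dist_eq, sub_zero, abs_of_nonneg (by positivity)] at hNy
  rw [Real.dist_eq]
  exact hb.trans_lt hNy

/-- ★★★ **DESORPTION**: `b(y,z) → 0` as `y → 0⁺` (`z > 0` fixed). [cite: BeatonBousquetMelouDeGierDuminilCopinGuttmann2014, §3.2 Proposition 6 (arXiv v5 p. 10); MadrasSlade1993, §8.5 pp. 278–279] -/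
theorem tendsto_contactB_nhdsGT_zero (hz : 0 < z) : Tendsto (fun y => contactB y z) (𝓝[>] 0) (𝓝 0) := by
  have hlim : Tendsto (fun y : ℝ => 2 * y / z ^ 2) (𝓝[>] 0) (𝓝 0) := by
    have : Tendsto (fun y : ℝ => 2 * y / z ^ 2) (𝓝 0) (𝓝 (2 * 0 / z ^ 2)) :=
      ((continuous_const.mul continuous_id).div_const _).tendsto 0
    rw [mul_zero, zero_div] at this
    exact this.mono_left nhdsWithin_le_nhds
  have hpos : ∀ᶠ y in 𝓝[>] (0 : ℝ), 0 < y := eventually_mem_nhdsWithin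
  have hsmall : ∀ᶠ y in 𝓝[>] (0 : ℝ), 2 * y ≤ z :=
    (ge_mem_nhds (by linarith : (0 : ℝ) < z / 2)).filter_mono nhdsWithin_le_nhds |>.mono fun y hy => by linarith
  refine squeeze_zero' (hpos.mono fun y hy => (contactB_facts hy hz).2.2.2.2.1.le) ?_ hlim
  filter_upwards [hpos, hsmall] with y hy h2y
  exact contactB_le_of_small hy hz h2y

/-! ## §12 (ed.3) The phase portrait in `z`: `b(y,z) → 1/2` as `z → 0⁺` (the top wall repels), `b(y,z) → 0` as `z → ∞` -/

/-- The swapped bounds (`μ_1(y,z) = μ_1(z,y)`): `s − z ≤ y/(z − y)` when `z > y`, and `s − y ≤ 2z/y` when `2z ≤ y`.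
[cite: BeatonBousquetMelouDeGierDuminilCopinGuttmann2014, Proposition 6 (arXiv v5 p. 10: μ_T(y,z) symmetric)] -/
theorem stripMuY₂_one_sq_sub_le' (hy : 0 < y) (hz : 0 < z) :
    (y < z → stripMuY₂ 1 y z ^ 2 - z ≤ y / (z - y)) ∧ (2 * z ≤ y → stripMuY₂ 1 y z ^ 2 - y ≤ 2 * z / y) := by
  have h := stripMuY₂_one_sq_sub_le hz hy
  rw [stripMuY₂_symm 1 z y] at h
  exact h

/-- ★★ `b(y,z) ≤ y/(2(z − y)²)` for `z > y` (a very attractive top wall empties the bottom one).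
[cite: BeatonBousquetMelouDeGierDuminilCopinGuttmann2014, §3.2 Proposition 6 (arXiv v5 p. 10); MadrasSlade1993, §1.2] -/
theorem contactB_le_of_large_top (hy : 0 < y) (hz : 0 < z) (hyz : y < z) : contactB y z ≤ y / (2 * (z - y) ^ 2) := by
  obtain ⟨hys, hzs, hF, hsex, hb0, hb1⟩ := contactB_facts hy hz
  have hsz := (stripMuY₂_one_sq_sub_le' hy hz).1 hyz
  set s := stripMuY₂ 1 y z ^ 2 with hs
  have hb : contactB y z = s * (s - z) / (2 * sexticDeriv y z s) := rfl
  have hs0 : 0 < s := hy.trans hys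
  have hzy : 0 < z - y := by linarith
  have hA : contactB y z ≤ s * (s - z) / (2 * (s * (s - y))) := by
    rw [hb]
    apply div_le_div_of_nonneg_left (mul_nonneg hs0.le (sub_pos.2 hzs).le) (by positivity)
    unfold sexticDeriv
    nlinarith [mul_pos (sub_pos.2 hys) (sub_pos.2 hzs), mul_pos hs0 (sub_pos.2 hzs)]
  have hB : s * (s - z) / (2 * (s * (s - y))) = (s - z) / (2 * (s - y)) := by field_simp
  have hC : (s - z) / (2 * (s - y)) ≤ y / (2 * (z - y) ^ 2) := by
    rw [div_le_div_iff₀ (by linarith) (by positivity)]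
    have h1 : (s - z) * (z - y) ≤ y := by rwa [le_div_iff₀ hzy] at hsz
    have h2 : z - y ≤ s - y := by linarith
    nlinarith [mul_le_mul_of_nonneg_right h1 hzy.le, mul_le_mul_of_nonneg_left h2 hy.le]
  calc contactB y z ≤ s * (s - z) / (2 * (s * (s - y))) := hA
    _ = (s - z) / (2 * (s - y)) := hB
    _ ≤ y / (2 * (z - y) ^ 2) := hC

/-- ★★ `|b(y,z) − 1/2| ≤ 4z/y²` for `0 < 2z ≤ y` (a repelling top wall confines the walk to the bottom row: every other site
is a contact). [cite: BeatonBousquetMelouDeGierDuminilCopinGuttmann2014, §3.2 Proposition 6 (arXiv v5 p. 10); MadrasSlade1993, §1.2] -/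
theorem abs_contactB_sub_half_le_of_small_top (hy : 0 < y) (hz : 0 < z) (h2z : 2 * z ≤ y) :
    |contactB y z - 1 / 2| ≤ 4 * z / y ^ 2 := by
  obtain ⟨hys, hzs, hF, hsex, hb0, hb1⟩ := contactB_facts hy hz
  have hsy := (stripMuY₂_one_sq_sub_le' hy hz).2 h2z
  set s := stripMuY₂ 1 y z ^ 2 with hs
  have hs0 : 0 < s := hy.trans hys
  have hb : contactB y z = s * (s - z) / (2 * sexticDeriv y z s) := rfl
  rw [abs_sub_comm, abs_of_nonneg (by linarith)]
  have h2F : 2 * sexticDeriv y z s ≠ 0 := by positivity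
  have key : 1 / 2 - contactB y z = (s - y) * (2 * s - z) / (2 * sexticDeriv y z s) := by
    rw [hb, eq_div_iff h2F, sub_mul, div_mul_cancel₀ _ h2F]; unfold sexticDeriv; ring
  rw [key]
  have hA : (s - y) * (2 * s - z) / (2 * sexticDeriv y z s) ≤ (s - y) / (s - z) := by
    rw [div_le_div_iff₀ (by positivity) (sub_pos.2 hzs)]
    unfold sexticDeriv
    have h1 : 0 ≤ s - y := (sub_pos.2 hys).le
    have h2 : (2 * s - z) * (s - z) ≤ 2 * ((s - y) * (s - z) + s * (s - z) + s * (s - y)) := by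
      nlinarith [mul_pos (sub_pos.2 hys) (sub_pos.2 hzs), mul_pos hs0 (sub_pos.2 hys), mul_pos hs0 (sub_pos.2 hzs)]
    nlinarith [mul_le_mul_of_nonneg_left h2 h1]
  have hB : (s - y) / (s - z) ≤ 4 * z / y ^ 2 := by
    rw [div_le_div_iff₀ (sub_pos.2 hzs) (by positivity)]
    have h1 : (s - y) * y ≤ 2 * z := by rwa [le_div_iff₀ hy] at hsy
    have h2 : y ≤ 2 * (s - z) := by linarith
    nlinarith [mul_le_mul_of_nonneg_right h1 hy.le, mul_le_mul_of_nonneg_left h2 (by linarith : (0:ℝ) ≤ 2 * z)]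
  exact hA.trans hB

/-- ★★★ **A very attractive top wall empties the bottom wall**: `b(y,z) → 0` as `z → ∞` (`y > 0` fixed).
[cite: BeatonBousquetMelouDeGierDuminilCopinGuttmann2014, §3.2 Proposition 6 (arXiv v5 p. 10); MadrasSlade1993, §8.5 pp. 278–279] -/
theorem tendsto_contactB_atTop_right (hy : 0 < y) : Tendsto (fun z => contactB y z) atTop (𝓝 0) := by
  have h1 : Tendsto (fun z : ℝ => z - y) atTop atTop := tendsto_atTop_add_const_right _ (-y) tendsto_id
  have h2 : Tendsto (fun z : ℝ => 2 * (z - y) ^ 2) atTop atTop :=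
    (Filter.tendsto_pow_atTop two_ne_zero |>.comp h1).const_mul_atTop two_pos
  have hlim : Tendsto (fun z : ℝ => y / (2 * (z - y) ^ 2)) atTop (𝓝 0) := tendsto_const_nhds.div_atTop h2
  have hpos : ∀ᶠ z : ℝ in atTop, y < z := eventually_gt_atTop y
  refine squeeze_zero' (hpos.mono fun z hz => (contactB_facts hy (hy.trans hz)).2.2.2.2.1.le) ?_ hlim
  exact hpos.mono fun z hz => contactB_le_of_large_top hy (hy.trans hz) hz

/-- ★★★ **A repelling top wall fills the bottom wall**: `b(y,z) → 1/2` as `z → 0⁺` (`y > 0` fixed).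
[cite: BeatonBousquetMelouDeGierDuminilCopinGuttmann2014, §3.2 Proposition 6 (arXiv v5 p. 10); MadrasSlade1993, §8.5 pp. 278–279] -/
theorem tendsto_contactB_nhdsGT_zero_right (hy : 0 < y) : Tendsto (fun z => contactB y z) (𝓝[>] 0) (𝓝 (1 / 2)) := by
  have hlim : Tendsto (fun z : ℝ => 4 * z / y ^ 2) (𝓝[>] 0) (𝓝 0) := by
    have : Tendsto (fun z : ℝ => 4 * z / y ^ 2) (𝓝 0) (𝓝 (4 * 0 / y ^ 2)) :=
      ((continuous_const.mul continuous_id).div_const _).tendsto 0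
    rw [mul_zero, zero_div] at this
    exact this.mono_left nhdsWithin_le_nhds
  have hpos : ∀ᶠ z in 𝓝[>] (0 : ℝ), 0 < z := eventually_mem_nhdsWithin
  have hsmall : ∀ᶠ z in 𝓝[>] (0 : ℝ), 2 * z ≤ y :=
    (ge_mem_nhds (by linarith : (0 : ℝ) < y / 2)).filter_mono nhdsWithin_le_nhds |>.mono fun z hz => by linarith
  rw [tendsto_iff_norm_sub_tendsto_zero]
  refine squeeze_zero' (Eventually.of_forall fun z => norm_nonneg _) ?_ hlim
  filter_upwards [hpos, hsmall] with z hz h2z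
  rw [Real.norm_eq_abs]
  exact abs_contactB_sub_half_le_of_small_top hy hz h2z

/-! ## §13 (ed.3) Competition between the walls: `b(y,z)` is STRICTLY decreasing in `z` (derivative-free) -/

/-- ★ **Eliminating `z`**: `b(y,z) = 1 / (2·(3 − 2y/s + (s − y)²/y))`, `s = μ_1(y,z)²` — by the sextic law
`(s − y)/(s − z) = (s − y)/s + (s − y)²/y`. [cite: BeatonBousquetMelouDeGierDuminilCopinGuttmann2014, §3.2 Proposition 6 (arXiv v5 p. 10)] -/
theorem contactB_eq_elim (hy : 0 < y) (hz : 0 < z) :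
    contactB y z = 1 / (2 * (3 - 2 * y / stripMuY₂ 1 y z ^ 2 + (stripMuY₂ 1 y z ^ 2 - y) ^ 2 / y)) := by
  obtain ⟨hys, hzs, hF, hsex, hb0, hb1⟩ := contactB_facts hy hz
  have hs0 : 0 < stripMuY₂ 1 y z ^ 2 := hy.trans hys
  have hb : contactB y z = stripMuY₂ 1 y z ^ 2 * (stripMuY₂ 1 y z ^ 2 - z) / (2 * sexticDeriv y z (stripMuY₂ 1 y z ^ 2)) := rfl
  have hD : 0 < 3 - 2 * y / stripMuY₂ 1 y z ^ 2 + (stripMuY₂ 1 y z ^ 2 - y) ^ 2 / y := by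
    have : 2 * y / stripMuY₂ 1 y z ^ 2 < 2 := by rw [div_lt_iff₀ hs0]; linarith
    have : 0 ≤ (stripMuY₂ 1 y z ^ 2 - y) ^ 2 / y := by positivity
    linarith
  rw [hb, div_eq_div_iff (by positivity) (by positivity)]
  unfold sexticDeriv
  have hs0' : stripMuY₂ 1 y z ^ 2 ≠ 0 := hs0.ne'
  have hy0' : y ≠ 0 := hy.ne'
  have hμ0' : stripMuY₂ 1 y z ≠ 0 := (stripMuY₂_pos 1 hy hz).ne'
  have e1 : 3 - 2 * y / stripMuY₂ 1 y z ^ 2 + (stripMuY₂ 1 y z ^ 2 - y) ^ 2 / y =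
      (3 * stripMuY₂ 1 y z ^ 2 * y - 2 * y * y + (stripMuY₂ 1 y z ^ 2 - y) ^ 2 * stripMuY₂ 1 y z ^ 2) /
        (stripMuY₂ 1 y z ^ 2 * y) := by
    field_simp
  rw [e1, one_mul, mul_comm, ← mul_assoc, eq_comm]
  rw [show (2 : ℝ) * ((3 * stripMuY₂ 1 y z ^ 2 * y - 2 * y * y + (stripMuY₂ 1 y z ^ 2 - y) ^ 2 * stripMuY₂ 1 y z ^ 2) /
      (stripMuY₂ 1 y z ^ 2 * y)) * stripMuY₂ 1 y z ^ 2 * (stripMuY₂ 1 y z ^ 2 - z) =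
      (2 * (3 * stripMuY₂ 1 y z ^ 2 * y - 2 * y * y + (stripMuY₂ 1 y z ^ 2 - y) ^ 2 * stripMuY₂ 1 y z ^ 2) *
        (stripMuY₂ 1 y z ^ 2 - z)) / y by field_simp]
  rw [eq_div_iff hy0']
  linear_combination (-2 * (stripMuY₂ 1 y z ^ 2 - y)) * hsex

/-- ★★★ **COMPETITION BETWEEN THE WALLS: the bottom adsorbed fraction is STRICTLY DECREASING in the top fugacity**:
`z < z' ⇒ b(y,z') < b(y,z)` (`y, z > 0`). Derivative-free: `b = 1/(2D(s))` with `D(s) = 3 − 2y/s + (s−y)²/y` strictly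
increasing in `s > y`, and `s = μ_1(y,z)²` strictly increasing in `z` (tree: `stripMuY₂_one_strictMono_right`).
[cite: BeatonBousquetMelouDeGierDuminilCopinGuttmann2014, §3.2 Proposition 6 (arXiv v5 p. 10); MadrasSlade1993, §1.2] -/
theorem contactB_strictAnti_right (hy : 0 < y) (hz : 0 < z) {z' : ℝ} (hzz' : z < z') : contactB y z' < contactB y z := by
  have hz' : 0 < z' := hz.trans hzz'
  obtain ⟨hys, -, -, -, -, -⟩ := contactB_facts hy hz
  obtain ⟨hys', -, -, -, -, -⟩ := contactB_facts hy hz'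
  have hμ := stripMuY₂_pos 1 hy hz
  have hlt : stripMuY₂ 1 y z ^ 2 < stripMuY₂ 1 y z' ^ 2 :=
    pow_lt_pow_left₀ (stripMuY₂_one_strictMono_right hy hz hzz') hμ.le two_ne_zero
  set s := stripMuY₂ 1 y z ^ 2 with hs
  set s' := stripMuY₂ 1 y z' ^ 2 with hs'
  rw [contactB_eq_elim hy hz, contactB_eq_elim hy hz', ← hs, ← hs']
  have hs0 : 0 < s := hy.trans hys
  have hD : 0 < 3 - 2 * y / s + (s - y) ^ 2 / y := by
    have : 2 * y / s < 2 := by rw [div_lt_iff₀ hs0]; linarith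
    have : 0 ≤ (s - y) ^ 2 / y := by positivity
    linarith
  -- `D(s) < D(s')`
  have h1 : 2 * y / s' < 2 * y / s := div_lt_div_of_pos_left (by linarith) hs0 hlt
  have h2 : (s - y) ^ 2 / y < (s' - y) ^ 2 / y := by
    apply div_lt_div_of_pos_right _ hy
    nlinarith [sub_pos.2 hys, sub_pos.2 hys']
  have hDD : 3 - 2 * y / s + (s - y) ^ 2 / y < 3 - 2 * y / s' + (s' - y) ^ 2 / y := by linarith
  exact one_div_lt_one_div_of_lt (by positivity) (by linarith)

/-- ★★ **…and symmetrically the top adsorbed fraction `b(z,y)` is strictly decreasing in the bottom fugacity `y`.**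
[cite: BeatonBousquetMelouDeGierDuminilCopinGuttmann2014, Proposition 6 (arXiv v5 p. 10: μ_T(y,z) symmetric)] -/
theorem contactB_swap_strictAnti (hy : 0 < y) (hz : 0 < z) {y' : ℝ} (hyy' : y < y') : contactB z y' < contactB z y :=
  contactB_strictAnti_right hz hy hyy'

/-! ## §14 (ed.4) `b(y,z)` is STRICTLY increasing in `y` (derivative-free, `y` eliminated) -/

/-- ★ **Eliminating `y`**: `b(y,z) = 1 / (2·(1 + z(2s − z)/((s − z)(s(s − z) + z))))`, `s = μ_1(y,z)²` — by the sextic law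
`s − y = sz/(z + s(s−z))`. [cite: BeatonBousquetMelouDeGierDuminilCopinGuttmann2014, §3.2 Proposition 6 (arXiv v5 p. 10)] -/
theorem contactB_eq_elim' (hy : 0 < y) (hz : 0 < z) :
    contactB y z = 1 / (2 * (1 + z * (2 * stripMuY₂ 1 y z ^ 2 - z) /
      ((stripMuY₂ 1 y z ^ 2 - z) * (stripMuY₂ 1 y z ^ 2 * (stripMuY₂ 1 y z ^ 2 - z) + z)))) := by
  obtain ⟨hys, hzs, hF, hsex, hb0, hb1⟩ := contactB_facts hy hz
  have hs0 : 0 < stripMuY₂ 1 y z ^ 2 := hy.trans hys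
  have hsz : 0 < stripMuY₂ 1 y z ^ 2 - z := sub_pos.2 hzs
  have hden : 0 < (stripMuY₂ 1 y z ^ 2 - z) * (stripMuY₂ 1 y z ^ 2 * (stripMuY₂ 1 y z ^ 2 - z) + z) := by positivity
  have hE : 0 ≤ z * (2 * stripMuY₂ 1 y z ^ 2 - z) / ((stripMuY₂ 1 y z ^ 2 - z) * (stripMuY₂ 1 y z ^ 2 * (stripMuY₂ 1 y z ^ 2 - z) + z)) :=
    div_nonneg (by nlinarith) hden.le
  have hb : contactB y z = stripMuY₂ 1 y z ^ 2 * (stripMuY₂ 1 y z ^ 2 - z) / (2 * sexticDeriv y z (stripMuY₂ 1 y z ^ 2)) := rfl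
  have hne1 : stripMuY₂ 1 y z ^ 2 - z ≠ 0 := hsz.ne'
  have hA : 0 < stripMuY₂ 1 y z ^ 2 * (stripMuY₂ 1 y z ^ 2 - z) + z := by positivity
  -- the sextic law as `(s − y)·A = s z`, `A = s(s−z) + z`
  have hsy : stripMuY₂ 1 y z ^ 2 - y = stripMuY₂ 1 y z ^ 2 * z / (stripMuY₂ 1 y z ^ 2 * (stripMuY₂ 1 y z ^ 2 - z) + z) := by
    rw [eq_div_iff hA.ne']; linear_combination hsex
  have hF : sexticDeriv y z (stripMuY₂ 1 y z ^ 2) = stripMuY₂ 1 y z ^ 2 * (stripMuY₂ 1 y z ^ 2 - z) +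
      stripMuY₂ 1 y z ^ 2 * z * (2 * stripMuY₂ 1 y z ^ 2 - z) / (stripMuY₂ 1 y z ^ 2 * (stripMuY₂ 1 y z ^ 2 - z) + z) := by
    unfold sexticDeriv; rw [hsy]; field_simp; ring
  rw [hb, hF]
  have hfac : stripMuY₂ 1 y z ^ 2 * (stripMuY₂ 1 y z ^ 2 - z) +
      stripMuY₂ 1 y z ^ 2 * z * (2 * stripMuY₂ 1 y z ^ 2 - z) / (stripMuY₂ 1 y z ^ 2 * (stripMuY₂ 1 y z ^ 2 - z) + z) =
      (stripMuY₂ 1 y z ^ 2 * (stripMuY₂ 1 y z ^ 2 - z)) * (1 + z * (2 * stripMuY₂ 1 y z ^ 2 - z) /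
        ((stripMuY₂ 1 y z ^ 2 - z) * (stripMuY₂ 1 y z ^ 2 * (stripMuY₂ 1 y z ^ 2 - z) + z))) := by
    have hA' := hA.ne'
    field_simp
  have hc0 : stripMuY₂ 1 y z ^ 2 * (stripMuY₂ 1 y z ^ 2 - z) ≠ 0 := (mul_pos hs0 hsz).ne'
  rw [hfac, show ∀ X : ℝ, 2 * (stripMuY₂ 1 y z ^ 2 * (stripMuY₂ 1 y z ^ 2 - z) * X) =
    stripMuY₂ 1 y z ^ 2 * (stripMuY₂ 1 y z ^ 2 - z) * (2 * X) from fun X => by ring, div_mul_eq_div_div, div_self hc0]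

/-- ★★★ **THE ADSORBED FRACTION IS STRICTLY INCREASING IN ITS OWN FUGACITY**: `y < y' ⇒ b(y,z) < b(y',z)` (`y, z > 0`).
Derivative-free: `E(s) = z(2 + z/(s−z))/(s(s−z) + z)` is strictly decreasing in `s > z` and `s = μ_1(y,z)²` is strictly
increasing in `y` (tree: `stripMuY₂_one_strictMono_left`). [cite: BeatonBousquetMelouDeGierDuminilCopinGuttmann2014, §3.2 Proposition 6 (arXiv v5 p. 10); MadrasSlade1993, §1.2] -/
theorem contactB_strictMono_left (hy : 0 < y) (hz : 0 < z) {y' : ℝ} (hyy' : y < y') : contactB y z < contactB y' z := by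
  have hy' : 0 < y' := hy.trans hyy'
  obtain ⟨-, hzs, -, -, -, -⟩ := contactB_facts hy hz
  obtain ⟨-, hzs', -, -, -, -⟩ := contactB_facts hy' hz
  have hμ := stripMuY₂_pos 1 hy hz
  have hlt : stripMuY₂ 1 y z ^ 2 < stripMuY₂ 1 y' z ^ 2 :=
    pow_lt_pow_left₀ (stripMuY₂_one_strictMono_left hy hz hyy') hμ.le two_ne_zero
  set s := stripMuY₂ 1 y z ^ 2 with hs
  set s' := stripMuY₂ 1 y' z ^ 2 with hs'
  rw [contactB_eq_elim' hy hz, contactB_eq_elim' hy' hz, ← hs, ← hs']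
  have hsz : 0 < s - z := sub_pos.2 hzs
  have hsz' : 0 < s' - z := sub_pos.2 hzs'
  have hs0 : 0 < s := hz.trans hzs
  -- `E(s') < E(s)` written with cleared denominators
  have hE : z * (2 * s' - z) / ((s' - z) * (s' * (s' - z) + z)) < z * (2 * s - z) / ((s - z) * (s * (s - z) + z)) := by
    rw [div_lt_div_iff₀ (by positivity) (by positivity)]
    -- (2s'−z)(s−z)(s(s−z)+z) < (2s−z)(s'−z)(s'(s'−z)+z): monotone pieces
    have h1 : (2 * s' - z) * (s - z) < (2 * s - z) * (s' - z) := by nlinarith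
    have h2 : s * (s - z) + z < s' * (s' - z) + z := by nlinarith
    have h3 : 0 < (2 * s - z) * (s' - z) := by nlinarith
    calc z * (2 * s' - z) * ((s - z) * (s * (s - z) + z))
        = z * (((2 * s' - z) * (s - z)) * (s * (s - z) + z)) := by ring
      _ < z * (((2 * s - z) * (s' - z)) * (s' * (s' - z) + z)) := by
          apply mul_lt_mul_of_pos_left _ hz
          calc (2 * s' - z) * (s - z) * (s * (s - z) + z) ≤ (2 * s - z) * (s' - z) * (s * (s - z) + z) :=
                mul_le_mul_of_nonneg_right h1.le (by positivity)
            _ < (2 * s - z) * (s' - z) * (s' * (s' - z) + z) := mul_lt_mul_of_pos_left h2 h3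
      _ = z * (2 * s - z) * ((s' - z) * (s' * (s' - z) + z)) := by ring
  have hpos : 0 < 1 + z * (2 * s' - z) / ((s' - z) * (s' * (s' - z) + z)) := by
    have : 0 ≤ z * (2 * s' - z) / ((s' - z) * (s' * (s' - z) + z)) := div_nonneg (by nlinarith) (by positivity)
    linarith
  exact one_div_lt_one_div_of_lt (by positivity) (by linarith)

/-- ★★ **The more attractive wall carries more contacts**: `b(y,z) < b(z,y) ↔ y < z` and `b(y,z) = b(z,y) ↔ y = z`
(`b(y,z) = s(s−z)/(2F)`, `b(z,y) = s(s−y)/(2F)`). [cite: BeatonBousquetMelouDeGierDuminilCopinGuttmann2014, Proposition 6 (arXiv v5 p. 10: μ_T(y,z) symmetric)] -/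
theorem contactB_lt_swap_iff (hy : 0 < y) (hz : 0 < z) : contactB y z < contactB z y ↔ y < z := by
  obtain ⟨hys, hzs, hF, -, -, -⟩ := contactB_facts hy hz
  have hs0 : 0 < stripMuY₂ 1 y z ^ 2 := hy.trans hys
  rw [contactB_swap y z]
  unfold contactB
  rw [div_lt_div_iff_of_pos_right (by positivity)]
  constructor
  · intro h; nlinarith
  · intro h; nlinarith

/-- `b(y,z) = b(z,y) ↔ y = z`. [cite: BeatonBousquetMelouDeGierDuminilCopinGuttmann2014, Proposition 6 (arXiv v5 p. 10: μ_T(y,z) symmetric)] -/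
theorem contactB_eq_swap_iff (hy : 0 < y) (hz : 0 < z) : contactB y z = contactB z y ↔ y = z := by
  constructor
  · intro h
    rcases lt_trichotomy y z with hlt | heq | hgt
    · exact absurd h ((contactB_lt_swap_iff hy hz).2 hlt).ne
    · exact heq
    · exact absurd h.symm ((contactB_lt_swap_iff hz hy).2 hgt).ne
  · rintro rfl; rfl

/-! ## §15 (ed.5) Consequences for the two-wall SPEED `v(y,z) = 2(b(y,z) + b(z,y))`: `v → 1` when either wall dominates -/

/-- ★★ **`v(y,z) → 1` as `y → ∞`** (`z > 0` fixed): the walk runs along the bottom wall. [cite: BeatonBousquetMelouDeGierDuminilCopinGuttmann2014, §3.2 Proposition 6 (arXiv v5 p. 10); MadrasSlade1993, §1.1 eq. (1.1.5)] -/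
theorem tendsto_twoWallSpeed_atTop (hz : 0 < z) : Tendsto (fun y => twoWallSpeed y z) atTop (𝓝 1) := by
  have h1 := tendsto_contactB_atTop hz                 -- b(y,z) → 1/2
  have h2 := tendsto_contactB_atTop_right hz           -- b(z,y) → 0  (first argument z fixed, second → ∞)
  have h : Tendsto (fun y => 2 * (contactB y z + contactB z y)) atTop (𝓝 (2 * (1 / 2 + 0))) :=
    (h1.add h2).const_mul 2
  rw [show (2 : ℝ) * (1 / 2 + 0) = 1 by norm_num] at h
  refine h.congr' ?_
  filter_upwards [eventually_gt_atTop 0] with y hy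
  rw [contactB_add_contactB_swap hy hz]; ring

/-- ★★ **`v(y,z) → 1` as `y → 0⁺`** (`z > 0` fixed): a repelling bottom wall sends the walk along the top wall.
[cite: BeatonBousquetMelouDeGierDuminilCopinGuttmann2014, §3.2 Proposition 6 (arXiv v5 p. 10); MadrasSlade1993, §1.1 eq. (1.1.5)] -/
theorem tendsto_twoWallSpeed_nhdsGT_zero (hz : 0 < z) : Tendsto (fun y => twoWallSpeed y z) (𝓝[>] 0) (𝓝 1) := by
  have h1 := tendsto_contactB_nhdsGT_zero hz            -- b(y,z) → 0
  have h2 := tendsto_contactB_nhdsGT_zero_right hz      -- b(z,y) → 1/2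
  have h : Tendsto (fun y => 2 * (contactB y z + contactB z y)) (𝓝[>] 0) (𝓝 (2 * (0 + 1 / 2))) :=
    (h1.add h2).const_mul 2
  rw [show (2 : ℝ) * (0 + 1 / 2) = 1 by norm_num] at h
  refine h.congr' ?_
  filter_upwards [self_mem_nhdsWithin] with y hy
  rw [contactB_add_contactB_swap hy hz]; ring

/-- ★★ **`2/3 < v(y,z) < 1`** for all `y, z > 0` (`v = 1 − 1/M`, `M > 3`). [cite: MadrasSlade1993, §1.1 eq. (1.1.5); BeatonBousquetMelouDeGierDuminilCopinGuttmann2014, §3.2 Proposition 6 (arXiv v5 p. 10)] -/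
theorem twoWallSpeed_mem_Ioo (hy : 0 < y) (hz : 0 < z) : twoWallSpeed y z ∈ Set.Ioo (2 / 3) 1 := by
  obtain ⟨hyx, hzx, hM, -⟩ := twoWall_critical_facts hy hz
  have hμ := stripMuY₂_pos 1 hy hz
  have hM3 : 3 < twoWallM y z := by
    unfold twoWallM
    have h1 : 0 < y * (stripMuY₂ 1 y z)⁻¹ ^ 2 / (1 - y * (stripMuY₂ 1 y z)⁻¹ ^ 2) := div_pos (by positivity) (by linarith)
    have h2 : 0 < z * (stripMuY₂ 1 y z)⁻¹ ^ 2 / (1 - z * (stripMuY₂ 1 y z)⁻¹ ^ 2) := div_pos (by positivity) (by linarith)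
    linarith
  rw [twoWallSpeed, twoWallRho, Set.mem_Ioo]
  constructor
  · have : 1 / twoWallM y z < 1 / 3 := by
      rw [div_lt_div_iff₀ hM (by norm_num)]; linarith
    linarith
  · have : 0 < 1 / twoWallM y z := by positivity
    linarith

/-- ★★ **The diagonal two-wall speed**: `v(y,y) = 1 − 1/(2 μ_1(y,y) + 3)` for every `y > 0` — the formula `v = 2(μ+1)/(2μ+3)` of the
unweighted walk persists along the whole diagonal with `μ ↦ μ_1(y,y)` (`M(y,y) = 3 + 2y/(s − y) = 3 + 2√s` since `(s − y)² = y²/s`).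
[cite: BeatonBousquetMelouDeGierDuminilCopinGuttmann2014, §3.2 Proposition 6 (arXiv v5 p. 10); MadrasSlade1993, §1.1 eq. (1.1.5)] -/
theorem twoWallSpeed_self (hy : 0 < y) : twoWallSpeed y y = 1 - 1 / (2 * stripMuY₂ 1 y y + 3) := by
  obtain ⟨hys, -, -, hsex, -, -⟩ := contactB_facts hy hy
  have hμ := stripMuY₂_pos 1 hy hy
  set μ := stripMuY₂ 1 y y with hμdef
  -- from the sextic on the diagonal: `μ (μ² − y) = y` (the positive square root of `(s − y)² = y²/s`)
  have hsq : (μ * (μ ^ 2 - y)) ^ 2 = y ^ 2 := by nlinarith [hsex]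
  have hpos : 0 < μ * (μ ^ 2 - y) := mul_pos hμ (by linarith)
  have hcubic : μ * (μ ^ 2 - y) = y := by
    have h2 : (μ * (μ ^ 2 - y) - y) * (μ * (μ ^ 2 - y) + y) = 0 := by nlinarith [hsq]
    rcases mul_eq_zero.1 h2 with h | h
    · linarith
    · linarith
  rw [twoWallSpeed, twoWallRho, twoWallM]
  have e1 : y * μ⁻¹ ^ 2 / (1 - y * μ⁻¹ ^ 2) = μ := by
    have hne : μ ^ 2 - y ≠ 0 := by linarith
    have : 1 - y * μ⁻¹ ^ 2 = (μ ^ 2 - y) / μ ^ 2 := by field_simp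
    rw [this, div_div_eq_mul_div]
    field_simp
    nlinarith [hcubic]
  rw [e1]
  ring

end Literature.Probability.RandomPlanarGeometry.SAW.HexBW
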